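import Literature.Probability.LatticeModels.MarkovChainMarkovProperty
import Literature.Probability.LatticeModels.MarkovChainConditioning
import Literature.Probability.LatticeModels.CylinderFunctionApprox
import Mathlib.MeasureTheory.Integral.Prod
import Mathlib.MeasureTheory.Integral.Bochner.ContinuousLinearMap
import Mathlib.MeasureTheory.Function.L2Space
import Mathlib.Analysis.SpecialFunctions.Pow.Real
import Mathlib.Analysis.SpecificLimits.Basic
import HarnessLib

/-!
# Exponential decay of correlations (ρ-mixing) of the stationary Markov chain of a real
# transfer kernel with an `L²` spectral gap

Topic `Literature/Probability/LatticeModels`; theorems only (no definitions, no named facts).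
Companion of `MarkovChainMarkovProperty.lean` / `MarkovChainConditioning.lean` (written for
`ℝ≥0∞`-valued data `k, φ, w, L, p, D` and `lintegral`s: one-site marginal, Markov property,
conditioning of a future window observable on the present spin, for the measure `μ` on `ℤ → S`
with the window formula `hμ`) and of `CylinderFunctionApprox.lean` (bounded cylinder functions
are dense in the `L²` functions of a set of coordinates).

In the applications (one-dimensional unbounded-spin chains, e.g. the pinned anharmonic chain) the
data are `k = ofReal ∘ K`, `φ = ofReal ∘ h`, `w = ofReal ∘ wt`, `L = ofReal λ₀` for a REAL bounded
kernel `0 ≤ K ≤ C`, a pointwise eigenfunction `0 < h ≤ B` (`∫ K(x,y) h(y) wt(y) dν(y) = λ₀ h(x)`,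
`∫ h² wt dν = 1`) and an integrable weight `wt > 0`, and mixing estimates are statements about
Bochner integrals of real observables. Part 1 of this file (section `RealForm`) PROVES the
dictionary:

* `ennreal_transferData` — measurability / nonvanishing / finiteness of `k, φ, w, L`, the
  `lintegral` eigen-equation and normalisation, from the real data;
* `transition_eq_ofReal` — `p(x,y) = ofReal (q(x,y))`, `q(x,y) = (λ₀ h(x))⁻¹ K(x,y) h(y) wt(y) ≥ 0`;
* `integrable_realTransition_mul`, `integral_realTransition_eq_one`,
  `lintegral_transition_mul_ofReal` — the real one-step operator `(Pu)(x) = ∫ q(x,y) u(y) dν(y)`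
  of a bounded measurable `u`, `P1 = 1`, and `∫⁻ p(x,y) ofReal(u y) = ofReal ((Pu)(x))` for `u ≥ 0`;
* `realMarkovOp_iterate_spec` — `Pⁿu` is measurable, bounded by the bound of `u`, nonnegative if
  `u` is, and `Pⁿ(u - c) = Pⁿu - c`; `iterate_transition_ofReal` — `P̃ⁿ(ofReal ∘ u) = ofReal ∘ Pⁿu`;
* `integral_comp_eval_eq_real` — one-site marginal `∫ u(σ_b) dμ = ∫ u h² wt dν`;
* `integral_mul_comp_eval_add_real` — Markov property `∫ f(σ) u(σ_{a+m+n}) dμ = ∫ f(σ) (Pⁿu)(σ_{a+m}) dμ`;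
* `exists_realCond_of_le` — for bounded measurable `0 ≤ g ≤ M` of the window `{b, …, b+m'}` a
  measurable `0 ≤ G ≤ M` with `∫ f g dμ = ∫ f(σ) G(σ_b) dμ` for all bounded measurable `f` of
  windows `{a, …, b}`.

Part 2 (section `Mixing`). HYPOTHESIS `hgap` (the input from spectral theory, verified for compact
positivity improving transfer operators from Jentzsch's theorem in
`Literature.Analysis.OperatorTheory.exists_groundState_markov_gap`): the real one-step operator
contracts mean-zero bounded functions in `L²(h² wt dν)` at rate `θ`,
`∫ (Pⁿu)² h² wt ≤ θ^{2n} ∫ u² h² wt` whenever `∫ u h² wt = 0`. CONCLUSION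
(Cassandro–Olivieri–Pellegrinotti–Presutti 1978 §3 for unbounded-spin chains; Georgii 2011
§10–11): for `f` an observable of the past `{i ≤ a}` and `g` of the future `{i ≥ a+n}`, both in
`L²(μ)`,

  `|∫ f g dμ - ∫ f dμ ∫ g dμ| ≤ 2 θⁿ (∫ f² dμ)^{1/2} (∫ g² dμ)^{1/2}`.

* `abs_integral_mul_sub_le_of_nonneg` — bounded window observables, `g ≥ 0`, constant `1`:
  `Cov(f,g) = ∫ f(σ) (Pⁿ(G - c))(σ_{a+m}) dμ` (`G = E[g | σ_{a+m+n}]`, `c = ∫ g`), Cauchy–Schwarz,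
  one-site marginal, the gap, and Jensen `∫ G² h² wt ≤ ∫ g²`;
* `abs_integral_mul_sub_le_of_window`, `abs_integral_mul_sub_le_of_dependsOn_Icc` — signed `g`
  (constant `2`), arbitrary finite windows;
* `abs_integral_mul_sub_le_of_dependsOn_halfLine` — **the theorem** for `L²` observables of the
  half-lines (density of bounded cylinder functions and `L²`-continuity of both sides).

[cite: Georgii2011, Thm 10.25 and §11.1]
-/

noncomputable section

open MeasureTheory Set Function Finset Filter
open scoped ENNReal

namespace Literature.Probability.LatticeModels

variable {S : Type*} [MeasurableSpace S] {ν : Measure S}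

section RealForm

variable {k p : S → S → ℝ≥0∞} {φ w : S → ℝ≥0∞} {L : ℝ≥0∞} {K q : S → S → ℝ} {h wt : S → ℝ}
  {lam C B : ℝ} {D : ℤ → ℕ → (ℤ → S) → ℝ≥0∞} {μ : Measure (ℤ → S)}

/-! ### The `ℝ≥0∞` transfer data of real data -/

/-- `K(x,y) h(y) wt(y)` is integrable in `y` (bounded kernel and eigenfunction, integrable weight).
[folklore] -/
theorem integrable_kernel_mul_mul (hKm : Measurable (uncurry K)) (hhm : Measurable h)
    (hwm : Measurable wt) (hK0 : ∀ x y, 0 ≤ K x y) (hKC : ∀ x y, K x y ≤ C) (hh0 : ∀ x, 0 < h x)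
    (hhB : ∀ x, h x ≤ B) (hwt0 : ∀ x, 0 < wt x) (hwi : Integrable wt ν) (x : S) :
    Integrable (fun y => K x y * h y * wt y) ν := by
  refine (hwi.const_mul (C * B)).mono'
    (((hKm.of_uncurry_left.mul hhm).mul hwm).aestronglyMeasurable) (ae_of_all _ fun y => ?_)
  have h1 := hK0 x y; have h2 := hKC x y; have h3 := hh0 y; have h4 := hhB y; have h5 := hwt0 y
  rw [Real.norm_eq_abs, abs_of_nonneg (by positivity)]
  have : K x y * h y ≤ C * B := mul_le_mul h2 h4 h3.le (h1.trans h2)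
  nlinarith

/-- **The `ℝ≥0∞` transfer data of real data.** For `k = ofReal ∘ K`, `φ = ofReal ∘ h`,
`w = ofReal ∘ wt`, `L = ofReal λ₀` with `K ≥ 0` bounded measurable, `0 < h ≤ B` measurable,
`wt > 0` measurable integrable, `λ₀ > 0`, the real eigen-equation and normalisation: `k, φ, w` are
measurable, `φ, w` are pointwise nonzero and finite, `0 < L < ∞`, and the `lintegral`
eigen-equation `∫⁻ k(z,y) φ(y) w(y) dν = L φ(z)` and normalisation `∫⁻ φ² w dν = 1` hold. [folklore] -/
theorem ennreal_transferData (hKm : Measurable (uncurry K)) (hhm : Measurable h)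
    (hwm : Measurable wt) (hK0 : ∀ x y, 0 ≤ K x y) (hKC : ∀ x y, K x y ≤ C) (hh0 : ∀ x, 0 < h x)
    (hhB : ∀ x, h x ≤ B) (hwt0 : ∀ x, 0 < wt x) (hwi : Integrable wt ν) (hlam : 0 < lam)
    (heig : ∀ x, ∫ y, K x y * h y * wt y ∂ν = lam * h x)
    (hnorm : ∫ y, h y ^ 2 * wt y ∂ν = 1)
    (hk : ∀ x y, k x y = ENNReal.ofReal (K x y)) (hφ : ∀ x, φ x = ENNReal.ofReal (h x))
    (hw : ∀ x, w x = ENNReal.ofReal (wt x)) (hL : L = ENNReal.ofReal lam) :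
    Measurable (uncurry k) ∧ Measurable φ ∧ Measurable w ∧ (∀ z, φ z ≠ 0) ∧ (∀ z, φ z ≠ ∞) ∧
      (∀ z, w z ≠ 0) ∧ (∀ z, w z ≠ ∞) ∧ L ≠ 0 ∧ L ≠ ∞ ∧
      (∀ z, ∫⁻ y, k z y * φ y * w y ∂ν = L * φ z) ∧ ∫⁻ y, φ y ^ 2 * w y ∂ν = 1 := by
  have hk' : uncurry k = fun z => ENNReal.ofReal (uncurry K z) := funext fun z => hk z.1 z.2
  have hφ' : φ = fun x => ENNReal.ofReal (h x) := funext hφ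
  have hw' : w = fun x => ENNReal.ofReal (wt x) := funext hw
  refine ⟨hk' ▸ ENNReal.measurable_ofReal.comp hKm, hφ' ▸ ENNReal.measurable_ofReal.comp hhm,
    hw' ▸ ENNReal.measurable_ofReal.comp hwm, fun z => ?_, fun z => ?_, fun z => ?_, fun z => ?_,
    ?_, ?_, fun z => ?_, ?_⟩
  · rw [hφ]; exact (ENNReal.ofReal_pos.2 (hh0 z)).ne'
  · rw [hφ]; exact ENNReal.ofReal_ne_top
  · rw [hw]; exact (ENNReal.ofReal_pos.2 (hwt0 z)).ne'
  · rw [hw]; exact ENNReal.ofReal_ne_top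
  · rw [hL]; exact (ENNReal.ofReal_pos.2 hlam).ne'
  · rw [hL]; exact ENNReal.ofReal_ne_top
  · have hint := integrable_kernel_mul_mul hKm hhm hwm hK0 hKC hh0 hhB hwt0 hwi z
    have hnn : 0 ≤ᵐ[ν] fun y => K z y * h y * wt y := ae_of_all _ fun y => by
      have := hK0 z y; have := hh0 y; have := hwt0 y; positivity
    rw [hL, hφ, ← ENNReal.ofReal_mul hlam.le, ← heig z, ofReal_integral_eq_lintegral_ofReal hint hnn]
    refine lintegral_congr fun y => ?_
    rw [hk, hφ, hw, ← ENNReal.ofReal_mul (hK0 z y), ← ENNReal.ofReal_mul (by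
      have := hK0 z y; have := hh0 y; positivity)]
  · have hint : Integrable (fun y => h y ^ 2 * wt y) ν := by
      refine (hwi.const_mul (B ^ 2)).mono' ((hhm.pow_const 2).mul hwm).aestronglyMeasurable
        (ae_of_all _ fun y => ?_)
      have h3 := hh0 y; have h4 := hhB y; have h5 := hwt0 y
      rw [Real.norm_eq_abs, abs_of_nonneg (by positivity)]
      have : h y ^ 2 ≤ B ^ 2 := pow_le_pow_left₀ h3.le h4 2
      nlinarith
    have hnn : 0 ≤ᵐ[ν] fun y => h y ^ 2 * wt y := ae_of_all _ fun y => by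
      have := hwt0 y; positivity
    rw [← ENNReal.ofReal_one, ← hnorm, ofReal_integral_eq_lintegral_ofReal hint hnn]
    refine lintegral_congr fun y => ?_
    rw [hφ, hw, ← ENNReal.ofReal_pow (hh0 y).le, ← ENNReal.ofReal_mul (sq_nonneg _)]

/-! ### The real transition density and the real one-step operator -/

omit [MeasurableSpace S] in
/-- The real transition density `q(x,y) = (λ₀ h(x))⁻¹ K(x,y) h(y) wt(y)` is nonnegative. [folklore] -/
theorem realTransition_nonneg (hK0 : ∀ x y, 0 ≤ K x y) (hh0 : ∀ x, 0 < h x) (hwt0 : ∀ x, 0 < wt x)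
    (hlam : 0 < lam) (hq : ∀ x y, q x y = (lam * h x)⁻¹ * K x y * h y * wt y) (x y : S) :
    0 ≤ q x y := by
  have := hK0 x y; have := hh0 x; have := hh0 y; have := hwt0 y
  rw [hq]; positivity

/-- The real transition density is jointly measurable. [folklore] -/
theorem measurable_realTransition (hKm : Measurable (uncurry K)) (hhm : Measurable h)
    (hwm : Measurable wt) (hq : ∀ x y, q x y = (lam * h x)⁻¹ * K x y * h y * wt y) :
    Measurable (uncurry q) := by
  have h' : uncurry q = fun z : S × S => (lam * h z.1)⁻¹ * K z.1 z.2 * h z.2 * wt z.2 :=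
    funext fun z => hq z.1 z.2
  rw [h']
  exact ((((hhm.comp measurable_fst).const_mul lam).inv.mul hKm).mul (hhm.comp measurable_snd)).mul
    (hwm.comp measurable_snd)

omit [MeasurableSpace S] in
/-- **`p = ofReal ∘ q`**: the `ℝ≥0∞` transition density `φ(x)⁻¹ L⁻¹ k(x,y) φ(y) w(y)` of the data
`ofReal ∘ (K, h, wt, λ₀)` is `ofReal` of the real transition density. [folklore] -/
theorem transition_eq_ofReal (hK0 : ∀ x y, 0 ≤ K x y) (hh0 : ∀ x, 0 < h x) (hwt0 : ∀ x, 0 < wt x)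
    (hlam : 0 < lam)
    (hk : ∀ x y, k x y = ENNReal.ofReal (K x y)) (hφ : ∀ x, φ x = ENNReal.ofReal (h x))
    (hw : ∀ x, w x = ENNReal.ofReal (wt x)) (hL : L = ENNReal.ofReal lam)
    (hp : ∀ x y, p x y = (φ x)⁻¹ * L⁻¹ * k x y * φ y * w y)
    (hq : ∀ x y, q x y = (lam * h x)⁻¹ * K x y * h y * wt y) (x y : S) :
    p x y = ENNReal.ofReal (q x y) := by
  have h1 := hK0 x y; have h2 := hh0 x; have h3 := hh0 y; have h4 := hwt0 y
  rw [hp, hq, hφ, hφ, hk, hw, hL, mul_inv, show lam⁻¹ * (h x)⁻¹ * K x y * h y * wt y =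
    (h x)⁻¹ * lam⁻¹ * K x y * h y * wt y by ring, ENNReal.ofReal_mul (by positivity),
    ENNReal.ofReal_mul (by positivity), ENNReal.ofReal_mul (by positivity),
    ENNReal.ofReal_mul (by positivity), ENNReal.ofReal_inv_of_pos h2, ENNReal.ofReal_inv_of_pos hlam]

/-- `q(x, ·) u` is integrable for a bounded measurable `u`. [folklore] -/
theorem integrable_realTransition_mul (hKm : Measurable (uncurry K)) (hhm : Measurable h)
    (hwm : Measurable wt) (hK0 : ∀ x y, 0 ≤ K x y) (hKC : ∀ x y, K x y ≤ C) (hh0 : ∀ x, 0 < h x)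
    (hhB : ∀ x, h x ≤ B) (hwt0 : ∀ x, 0 < wt x) (hwi : Integrable wt ν) (hlam : 0 < lam)
    (hq : ∀ x y, q x y = (lam * h x)⁻¹ * K x y * h y * wt y)
    {u : S → ℝ} (hum : Measurable u) {M : ℝ} (huM : ∀ x, |u x| ≤ M) (x : S) :
    Integrable (fun y => q x y * u y) ν := by
  have hqm := measurable_realTransition hKm hhm hwm hq
  refine (hwi.const_mul ((lam * h x)⁻¹ * C * B * M)).mono'
    ((hqm.of_uncurry_left.mul hum).aestronglyMeasurable) (ae_of_all _ fun y => ?_)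
  have h1 := hK0 x y; have h2 := hKC x y; have h3 := hh0 y; have h4 := hhB y; have h5 := hwt0 y
  have h6 := hh0 x; have h7 := huM y
  have hM : 0 ≤ M := (abs_nonneg _).trans h7
  rw [Real.norm_eq_abs, abs_mul, abs_of_nonneg (realTransition_nonneg hK0 hh0 hwt0 hlam hq x y), hq]
  have hc : 0 ≤ (lam * h x)⁻¹ := by positivity
  have hC0 : 0 ≤ C := h1.trans h2
  have hB0 : 0 ≤ B := h3.le.trans h4
  have : K x y * h y ≤ C * B := mul_le_mul h2 h4 h3.le hC0
  calc (lam * h x)⁻¹ * K x y * h y * wt y * |u y|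
      = (lam * h x)⁻¹ * (K x y * h y) * wt y * |u y| := by ring
    _ ≤ (lam * h x)⁻¹ * (C * B) * wt y * M := by gcongr
    _ = (lam * h x)⁻¹ * C * B * M * wt y := by ring

/-- **`∫⁻ p(x,y) ofReal(u y) dν(y) = ofReal (∫ q(x,y) u(y) dν(y))`** for bounded measurable
`u ≥ 0`: the `ℝ≥0∞` one-step operator on `ofReal ∘ u` is `ofReal` of the real one. [folklore] -/
theorem lintegral_transition_mul_ofReal (hKm : Measurable (uncurry K)) (hhm : Measurable h)
    (hwm : Measurable wt) (hK0 : ∀ x y, 0 ≤ K x y) (hKC : ∀ x y, K x y ≤ C) (hh0 : ∀ x, 0 < h x)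
    (hhB : ∀ x, h x ≤ B) (hwt0 : ∀ x, 0 < wt x) (hwi : Integrable wt ν) (hlam : 0 < lam)
    (hk : ∀ x y, k x y = ENNReal.ofReal (K x y)) (hφ : ∀ x, φ x = ENNReal.ofReal (h x))
    (hw : ∀ x, w x = ENNReal.ofReal (wt x)) (hL : L = ENNReal.ofReal lam)
    (hp : ∀ x y, p x y = (φ x)⁻¹ * L⁻¹ * k x y * φ y * w y)
    (hq : ∀ x y, q x y = (lam * h x)⁻¹ * K x y * h y * wt y)
    {u : S → ℝ} (hum : Measurable u) {M : ℝ} (huM : ∀ x, |u x| ≤ M) (hu0 : ∀ x, 0 ≤ u x) (x : S) :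
    ∫⁻ y, p x y * ENNReal.ofReal (u y) ∂ν = ENNReal.ofReal (∫ y, q x y * u y ∂ν) := by
  have hq0 := realTransition_nonneg hK0 hh0 hwt0 hlam hq
  rw [ofReal_integral_eq_lintegral_ofReal
    (integrable_realTransition_mul hKm hhm hwm hK0 hKC hh0 hhB hwt0 hwi hlam hq hum huM x)
    (ae_of_all _ fun y => mul_nonneg (hq0 x y) (hu0 y))]
  refine lintegral_congr fun y => ?_
  rw [transition_eq_ofReal hK0 hh0 hwt0 hlam hk hφ hw hL hp hq, ← ENNReal.ofReal_mul (hq0 x y)]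

/-- **`∫ q(x,y) dν(y) = 1`**: the real transition density is a probability density (the
eigen-equation). [cite: Georgii2011, Thm 10.25 and §11.1] -/
theorem integral_realTransition_eq_one (hh0 : ∀ x, 0 < h x) (hlam : 0 < lam)
    (heig : ∀ x, ∫ y, K x y * h y * wt y ∂ν = lam * h x)
    (hq : ∀ x y, q x y = (lam * h x)⁻¹ * K x y * h y * wt y) (x : S) :
    ∫ y, q x y ∂ν = 1 := by
  have h6 := hh0 x
  have h1 : ∀ y, q x y = (lam * h x)⁻¹ * (K x y * h y * wt y) := fun y => by rw [hq]; ring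
  simp_rw [h1]
  rw [integral_const_mul, heig, inv_mul_cancel₀ (by positivity)]

/-- **The real one-step operator and its iterates on bounded measurable functions.** For
`u` measurable with `|u| ≤ M`: every iterate `Pⁿu` of `(Pv)(x) = ∫ q(x,y) v(y) dν(y)` is
measurable with `|Pⁿu| ≤ M`; `Pⁿu ≥ 0` if `u ≥ 0`; and `Pⁿ(u - c) = Pⁿu - c` (`P1 = 1`). [folklore] -/
theorem realMarkovOp_iterate_spec [SFinite ν] (hKm : Measurable (uncurry K)) (hhm : Measurable h)
    (hwm : Measurable wt) (hK0 : ∀ x y, 0 ≤ K x y) (hKC : ∀ x y, K x y ≤ C) (hh0 : ∀ x, 0 < h x)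
    (hhB : ∀ x, h x ≤ B) (hwt0 : ∀ x, 0 < wt x) (hwi : Integrable wt ν) (hlam : 0 < lam)
    (heig : ∀ x, ∫ y, K x y * h y * wt y ∂ν = lam * h x)
    (hq : ∀ x y, q x y = (lam * h x)⁻¹ * K x y * h y * wt y)
    {u : S → ℝ} (hum : Measurable u) {M : ℝ} (huM : ∀ x, |u x| ≤ M) (n : ℕ) :
    Measurable ((fun (v : S → ℝ) (x : S) => ∫ y, q x y * v y ∂ν)^[n] u) ∧
      (∀ x, |((fun (v : S → ℝ) (x : S) => ∫ y, q x y * v y ∂ν)^[n] u) x| ≤ M) ∧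
      ((∀ x, 0 ≤ u x) → ∀ x, 0 ≤ ((fun (v : S → ℝ) (x : S) => ∫ y, q x y * v y ∂ν)^[n] u) x) ∧
      ∀ c : ℝ, ((fun (v : S → ℝ) (x : S) => ∫ y, q x y * v y ∂ν)^[n] (fun x => u x - c)) =
        fun x => ((fun (v : S → ℝ) (x : S) => ∫ y, q x y * v y ∂ν)^[n] u) x - c := by
  have hqm := measurable_realTransition hKm hhm hwm hq
  have hq0 := realTransition_nonneg hK0 hh0 hwt0 hlam hq
  have hq1 := integral_realTransition_eq_one hh0 hlam heig hq
  have hint := fun {v : S → ℝ} (hvm : Measurable v) {M' : ℝ} (hvM : ∀ x, |v x| ≤ M') =>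
    integrable_realTransition_mul hKm hhm hwm hK0 hKC hh0 hhB hwt0 hwi hlam hq hvm hvM
  -- one step
  have hstep : ∀ {v : S → ℝ}, Measurable v → ∀ {M' : ℝ}, (∀ x, |v x| ≤ M') →
      Measurable (fun x => ∫ y, q x y * v y ∂ν) ∧ (∀ x, |∫ y, q x y * v y ∂ν| ≤ M') ∧
      ((∀ x, 0 ≤ v x) → ∀ x, 0 ≤ ∫ y, q x y * v y ∂ν) ∧
      ∀ c : ℝ, (fun x => ∫ y, q x y * (v y - c) ∂ν) = fun x => (∫ y, q x y * v y ∂ν) - c := by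
    intro v hvm M' hvM
    refine ⟨(hqm.mul (hvm.comp measurable_snd)).stronglyMeasurable.integral_prod_right.measurable,
      fun x => ?_, fun hv0 x => integral_nonneg fun y => mul_nonneg (hq0 x y) (hv0 y), fun c => ?_⟩
    · have hq1i : Integrable (fun y => q x y) ν := by
        have := hint measurable_const (M' := |(1 : ℝ)|) (fun _ => le_rfl) x
        simpa using this
      have h1 : ‖∫ y, q x y * v y ∂ν‖ ≤ ∫ y, M' * q x y ∂ν :=
        norm_integral_le_of_norm_le (hq1i.const_mul M') (ae_of_all _ fun y => by
          rw [Real.norm_eq_abs, abs_mul, abs_of_nonneg (hq0 x y), mul_comm]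
          exact mul_le_mul_of_nonneg_right (hvM y) (hq0 x y))
      rw [Real.norm_eq_abs, integral_const_mul, hq1 x, mul_one] at h1
      exact h1
    · funext x
      have hc : ∀ x, |(fun _ : S => c) x| ≤ |c| := fun _ => le_rfl
      simp_rw [mul_sub]
      rw [integral_sub (hint hvm hvM x) (hint measurable_const hc x), integral_mul_const, hq1, one_mul]
  induction n with
  | zero =>
    exact ⟨hum, huM, fun h0 => h0, fun c => rfl⟩
  | succ n ih =>
    obtain ⟨ihm, ihM, ih0, ihc⟩ := ih
    obtain ⟨h1, h2, h3, h4⟩ := hstep ihm ihM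
    refine ⟨?_, ?_, ?_, fun c => ?_⟩
    · rw [Function.iterate_succ_apply']; exact h1
    · rw [Function.iterate_succ_apply']; exact h2
    · intro hu0; rw [Function.iterate_succ_apply']; exact h3 (ih0 hu0)
    · rw [Function.iterate_succ_apply', Function.iterate_succ_apply', ihc c]
      exact h4 c

/-- **`P̃ⁿ (ofReal ∘ u) = ofReal ∘ Pⁿu`** for bounded measurable `u ≥ 0`: the iterates of the
`ℝ≥0∞` one-step operator `(P̃v)(x) = ∫⁻ p(x,y) v(y) dν` and of the real one correspond. [folklore] -/
theorem iterate_transition_ofReal [SFinite ν] (hKm : Measurable (uncurry K)) (hhm : Measurable h)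
    (hwm : Measurable wt) (hK0 : ∀ x y, 0 ≤ K x y) (hKC : ∀ x y, K x y ≤ C) (hh0 : ∀ x, 0 < h x)
    (hhB : ∀ x, h x ≤ B) (hwt0 : ∀ x, 0 < wt x) (hwi : Integrable wt ν) (hlam : 0 < lam)
    (heig : ∀ x, ∫ y, K x y * h y * wt y ∂ν = lam * h x)
    (hk : ∀ x y, k x y = ENNReal.ofReal (K x y)) (hφ : ∀ x, φ x = ENNReal.ofReal (h x))
    (hw : ∀ x, w x = ENNReal.ofReal (wt x)) (hL : L = ENNReal.ofReal lam)
    (hp : ∀ x y, p x y = (φ x)⁻¹ * L⁻¹ * k x y * φ y * w y)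
    (hq : ∀ x y, q x y = (lam * h x)⁻¹ * K x y * h y * wt y)
    {u : S → ℝ} (hum : Measurable u) {M : ℝ} (huM : ∀ x, |u x| ≤ M) (hu0 : ∀ x, 0 ≤ u x) (n : ℕ) :
    ((fun (v : S → ℝ≥0∞) (x : S) => ∫⁻ y, p x y * v y ∂ν)^[n] fun y => ENNReal.ofReal (u y)) =
      fun x => ENNReal.ofReal (((fun (v : S → ℝ) (x : S) => ∫ y, q x y * v y ∂ν)^[n] u) x) := by
  induction n with
  | zero => rfl
  | succ n ih =>
    obtain ⟨hm, hM, h0, -⟩ :=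
      realMarkovOp_iterate_spec hKm hhm hwm hK0 hKC hh0 hhB hwt0 hwi hlam heig hq hum huM n
    rw [Function.iterate_succ_apply', Function.iterate_succ_apply', ih]
    funext x
    exact lintegral_transition_mul_ofReal hKm hhm hwm hK0 hKC hh0 hhB hwt0 hwi hlam hk hφ hw hL hp
      hq hm hM (h0 hu0) x

/-! ### Real-valued identities for the chain -/

/-- A bounded measurable real function on a finite measure space is integrable. [folklore] -/
theorem integrable_of_bound_measurable {Ω : Type*} [MeasurableSpace Ω] {μ' : Measure Ω} [IsFiniteMeasure μ']
    {F : Ω → ℝ} (hF : Measurable F) {M : ℝ} (hM : ∀ x, |F x| ≤ M) : Integrable F μ' :=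
  (integrable_const M).mono' hF.aestronglyMeasurable (ae_of_all _ fun x => by
    rw [Real.norm_eq_abs]; exact hM x)

/-- Passing an identity `∫ f X = ∫ f Y` from the positive and negative parts of `f` to `f`.
[folklore] -/
theorem integral_mul_eq_of_posPart_negPart {Ω : Type*} [MeasurableSpace Ω] {μ' : Measure Ω}
    [IsFiniteMeasure μ'] {f X Y : Ω → ℝ} (hf : Measurable f) (hX : Measurable X)
    (hY : Measurable Y) {Mf MX MY : ℝ} (hfM : ∀ x, |f x| ≤ Mf) (hXM : ∀ x, |X x| ≤ MX)
    (hYM : ∀ x, |Y x| ≤ MY)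
    (hpos : ∫ x, max (f x) 0 * X x ∂μ' = ∫ x, max (f x) 0 * Y x ∂μ')
    (hneg : ∫ x, max (-f x) 0 * X x ∂μ' = ∫ x, max (-f x) 0 * Y x ∂μ') :
    ∫ x, f x * X x ∂μ' = ∫ x, f x * Y x ∂μ' := by
  have hpm : Measurable fun x => max (f x) 0 := hf.max measurable_const
  have hnm : Measurable fun x => max (-f x) 0 := hf.neg.max measurable_const
  have hpb : ∀ x, |max (f x) 0| ≤ Mf := fun x => by
    rw [abs_of_nonneg (le_max_right _ _)]
    exact max_le ((le_abs_self _).trans (hfM x)) ((abs_nonneg _).trans (hfM x))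
  have hnb : ∀ x, |max (-f x) 0| ≤ Mf := fun x => by
    rw [abs_of_nonneg (le_max_right _ _)]
    exact max_le ((neg_le_abs _).trans (hfM x)) ((abs_nonneg _).trans (hfM x))
  have hprod : ∀ {g Z : Ω → ℝ}, Measurable g → Measurable Z → ∀ {Mg MZ : ℝ}, (∀ x, |g x| ≤ Mg) →
      (∀ x, |Z x| ≤ MZ) → Integrable (fun x => g x * Z x) μ' := by
    intro g Z hg hZ Mg MZ hgM hZM
    refine integrable_of_bound_measurable (hg.mul hZ) (M := Mg * MZ) fun x => ?_
    rw [abs_mul]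
    exact mul_le_mul (hgM x) (hZM x) (abs_nonneg _) ((abs_nonneg _).trans (hgM x))
  have hsplit : ∀ Z : Ω → ℝ, Measurable Z → ∀ {MZ : ℝ}, (∀ x, |Z x| ≤ MZ) →
      ∫ x, f x * Z x ∂μ' = ∫ x, max (f x) 0 * Z x ∂μ' - ∫ x, max (-f x) 0 * Z x ∂μ' := by
    intro Z hZ MZ hZM
    rw [← integral_sub (hprod hpm hZ hpb hZM) (hprod hnm hZ hnb hZM)]
    refine integral_congr_ae (ae_of_all _ fun x => ?_)
    dsimp only
    rw [← sub_mul, max_zero_sub_max_neg_zero_eq_self]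
  rw [hsplit X hX hXM, hsplit Y hY hYM, hpos, hneg]

/-- Conversion of a `lintegral` identity between products of nonnegative bounded measurable real
functions into the Bochner-integral identity. [folklore] -/
theorem integral_mul_eq_of_lintegral_ofReal_mul_eq {Ω : Type*} [MeasurableSpace Ω]
    {μ' : Measure Ω} {f X Y : Ω → ℝ} (hf : Measurable f) (hX : Measurable X) (hY : Measurable Y)
    (hf0 : ∀ x, 0 ≤ f x) (hX0 : ∀ x, 0 ≤ X x) (hY0 : ∀ x, 0 ≤ Y x)
    (H : ∫⁻ x, ENNReal.ofReal (f x) * ENNReal.ofReal (X x) ∂μ' =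
      ∫⁻ x, ENNReal.ofReal (f x) * ENNReal.ofReal (Y x) ∂μ') :
    ∫ x, f x * X x ∂μ' = ∫ x, f x * Y x ∂μ' := by
  rw [integral_eq_lintegral_of_nonneg_ae (ae_of_all _ fun x => mul_nonneg (hf0 x) (hX0 x))
      (hf.mul hX).aestronglyMeasurable,
    integral_eq_lintegral_of_nonneg_ae (ae_of_all _ fun x => mul_nonneg (hf0 x) (hY0 x))
      (hf.mul hY).aestronglyMeasurable]
  simp_rw [ENNReal.ofReal_mul (hf0 _)]
  rw [H]

/-- **One-site marginal, real form**: `∫ u(σ_b) dμ = ∫ u(y) h(y)² wt(y) dν(y)` for every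
measurable real `u` (the law of `σ_b` under `μ` is `h² wt dν`). [cite: Georgii2011, Thm 10.25 and §11.1] -/
theorem integral_comp_eval_eq_real [Nonempty S] (hhm : Measurable h) (hwm : Measurable wt)
    (hh0 : ∀ x, 0 < h x) (hwt0 : ∀ x, 0 < wt x) (hφ : ∀ x, φ x = ENNReal.ofReal (h x))
    (hw : ∀ x, w x = ENNReal.ofReal (wt x))
    (hD : ∀ a n σ, D a n σ = φ (σ a) * φ (σ (a + n)) *
      (∏ j ∈ Finset.range n, k (σ (a + j)) (σ (a + j + 1)) * L⁻¹) *
      ∏ j ∈ Finset.range (n + 1), w (σ (a + j)))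
    (hμ : ∀ (a : ℤ) (n : ℕ) (Φ : (ℤ → S) → ℝ≥0∞), Measurable Φ →
      DependsOn Φ (↑(Finset.Icc a (a + n)) : Set ℤ) → ∀ η : ℤ → S,
        ∫⁻ σ, Φ σ ∂μ = (∫⋯∫⁻_Finset.Icc a (a + n), (fun σ => Φ σ * D a n σ) ∂fun _ : ℤ => ν) η)
    {u : S → ℝ} (hum : Measurable u) (b : ℤ) :
    ∫ σ, u (σ b) ∂μ = ∫ y, u y * (h y ^ 2 * wt y) ∂ν := by
  have hdm : Measurable fun y => ENNReal.ofReal (h y ^ 2 * wt y) :=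
    ENNReal.measurable_ofReal.comp ((hhm.pow_const 2).mul hwm)
  have hmap : μ.map (fun σ : ℤ → S => σ b) =
      ν.withDensity (fun y => ENNReal.ofReal (h y ^ 2 * wt y)) := by
    refine Measure.ext fun s hs => ?_
    have hind : ∀ σ : ℤ → S, ((fun σ : ℤ → S => σ b) ⁻¹' s).indicator (1 : (ℤ → S) → ℝ≥0∞) σ =
        s.indicator (1 : S → ℝ≥0∞) (σ b) := fun σ => by
      by_cases hσ : σ b ∈ s <;> simp [hσ]
    rw [Measure.map_apply (measurable_pi_apply b) hs,
      ← lintegral_indicator_one ((measurable_pi_apply b) hs)]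
    simp_rw [hind]
    rw [lintegral_comp_eval_eq (k := k) (L := L) hD hμ (measurable_one.indicator hs) b,
      withDensity_apply _ hs, ← lintegral_indicator hs]
    refine lintegral_congr fun y => ?_
    rw [hφ, hw, ← ENNReal.ofReal_pow (hh0 y).le, ← ENNReal.ofReal_mul (sq_nonneg _)]
    by_cases hy : y ∈ s <;> simp [hy]
  rw [← integral_map (measurable_pi_apply b).aemeasurable hum.aestronglyMeasurable, hmap,
    integral_withDensity_eq_integral_toReal_smul hdm (ae_of_all _ fun _ => ENNReal.ofReal_lt_top)]
  refine integral_congr_ae (ae_of_all _ fun y => ?_)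
  dsimp only
  rw [ENNReal.toReal_ofReal (by have := hwt0 y; positivity), smul_eq_mul, mul_comm]

/-- **Markov property, real form.** For a bounded measurable real `f` depending on the window
`{a, …, a+m}` and a bounded measurable `u ≥ 0` on `S`,
`∫ f(σ) u(σ_{a+m+n}) dμ = ∫ f(σ) (Pⁿu)(σ_{a+m}) dμ` with the real one-step operator
`(Pv)(x) = ∫ q(x,y) v(y) dν(y)`. [cite: Georgii2011, Thm 10.25 and §11.1] -/
theorem integral_mul_comp_eval_add_real [Nonempty S] [SigmaFinite ν] [IsFiniteMeasure μ]
    (hKm : Measurable (uncurry K)) (hhm : Measurable h)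
    (hwm : Measurable wt) (hK0 : ∀ x y, 0 ≤ K x y) (hKC : ∀ x y, K x y ≤ C) (hh0 : ∀ x, 0 < h x)
    (hhB : ∀ x, h x ≤ B) (hwt0 : ∀ x, 0 < wt x) (hwi : Integrable wt ν) (hlam : 0 < lam)
    (heig : ∀ x, ∫ y, K x y * h y * wt y ∂ν = lam * h x)
    (hnorm : ∫ y, h y ^ 2 * wt y ∂ν = 1)
    (hk : ∀ x y, k x y = ENNReal.ofReal (K x y)) (hφ : ∀ x, φ x = ENNReal.ofReal (h x))
    (hw : ∀ x, w x = ENNReal.ofReal (wt x)) (hL : L = ENNReal.ofReal lam)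
    (hp : ∀ x y, p x y = (φ x)⁻¹ * L⁻¹ * k x y * φ y * w y)
    (hq : ∀ x y, q x y = (lam * h x)⁻¹ * K x y * h y * wt y)
    (hD : ∀ a n σ, D a n σ = φ (σ a) * φ (σ (a + n)) *
      (∏ j ∈ Finset.range n, k (σ (a + j)) (σ (a + j + 1)) * L⁻¹) *
      ∏ j ∈ Finset.range (n + 1), w (σ (a + j)))
    (hμ : ∀ (a : ℤ) (n : ℕ) (Φ : (ℤ → S) → ℝ≥0∞), Measurable Φ →
      DependsOn Φ (↑(Finset.Icc a (a + n)) : Set ℤ) → ∀ η : ℤ → S,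
        ∫⁻ σ, Φ σ ∂μ = (∫⋯∫⁻_Finset.Icc a (a + n), (fun σ => Φ σ * D a n σ) ∂fun _ : ℤ => ν) η)
    {f : (ℤ → S) → ℝ} (hfm : Measurable f) {Mf : ℝ} (hfM : ∀ σ, |f σ| ≤ Mf) {a : ℤ} {m : ℕ}
    (hfd : DependsOn f (↑(Finset.Icc a (a + m)) : Set ℤ))
    {u : S → ℝ} (hum : Measurable u) {M : ℝ} (huM : ∀ x, |u x| ≤ M) (hu0 : ∀ x, 0 ≤ u x) (n : ℕ) :
    ∫ σ, f σ * u (σ (a + m + n)) ∂μ =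
      ∫ σ, f σ * ((fun (v : S → ℝ) (x : S) => ∫ y, q x y * v y ∂ν)^[n] u) (σ (a + m)) ∂μ := by
  obtain ⟨hkm, hφm, hwm', hφ0, hφt, -, -, -, -, -, -⟩ :=
    ennreal_transferData hKm hhm hwm hK0 hKC hh0 hhB hwt0 hwi hlam heig hnorm hk hφ hw hL
  obtain ⟨hPm, hPM, hP0, -⟩ :=
    realMarkovOp_iterate_spec hKm hhm hwm hK0 hKC hh0 hhB hwt0 hwi hlam heig hq hum huM n
  -- nonnegative `f` first
  have key : ∀ g : (ℤ → S) → ℝ, Measurable g → (∀ σ, 0 ≤ g σ) →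
      DependsOn g (↑(Finset.Icc a (a + m)) : Set ℤ) →
      ∫ σ, g σ * u (σ (a + m + n)) ∂μ =
        ∫ σ, g σ * ((fun (v : S → ℝ) (x : S) => ∫ y, q x y * v y ∂ν)^[n] u) (σ (a + m)) ∂μ := by
    intro g hgm hg0 hgd
    refine integral_mul_eq_of_lintegral_ofReal_mul_eq hgm (hum.comp (measurable_pi_apply _))
      (hPm.comp (measurable_pi_apply _)) hg0 (fun σ => hu0 _) (fun σ => hP0 hu0 _) ?_
    have h1 := lintegral_mul_comp_eval_add hkm hφm hwm' hD hp hφ0 hφt hμ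
      (Φ := fun σ => ENNReal.ofReal (g σ)) (ENNReal.measurable_ofReal.comp hgm) (a := a) (m := m)
      (fun x y hxy => by show ENNReal.ofReal (g x) = ENNReal.ofReal (g y); rw [hgd hxy]) n
      (v := fun y => ENNReal.ofReal (u y)) (ENNReal.measurable_ofReal.comp hum)
    rw [iterate_transition_ofReal hKm hhm hwm hK0 hKC hh0 hhB hwt0 hwi hlam heig hk hφ hw hL hp hq
      hum huM hu0 n] at h1
    exact h1
  exact integral_mul_eq_of_posPart_negPart hfm (hum.comp (measurable_pi_apply _))
    (hPm.comp (measurable_pi_apply _)) hfM (fun σ => huM _) (fun σ => hPM _)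
    (key (fun σ => max (f σ) 0) (hfm.max measurable_const) (fun σ => le_max_right _ _)
      fun x y hxy => by show max (f x) 0 = max (f y) 0; rw [hfd hxy])
    (key (fun σ => max (-f σ) 0) (hfm.neg.max measurable_const) (fun σ => le_max_right _ _)
      fun x y hxy => by show max (-f x) 0 = max (-f y) 0; rw [hfd hxy])

/-- **Conditioning a bounded future window observable on the present spin, real form.** For a
measurable `0 ≤ g ≤ M` depending on the window `{b, …, b+m'}` there is a measurable `0 ≤ G ≤ M`
on `S` (`G(y) = E[g | σ_b = y]`) with `∫ f g dμ = ∫ f(σ) G(σ_b) dμ` for every bounded measurable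
real `f` of a window `{a, …, a+m = b}`. [cite: Georgii2011, Thm 10.25 and §11.1] -/
theorem exists_realCond_of_le [Nonempty S] [SigmaFinite ν] [IsFiniteMeasure μ]
    (hKm : Measurable (uncurry K)) (hhm : Measurable h)
    (hwm : Measurable wt) (hK0 : ∀ x y, 0 ≤ K x y) (hKC : ∀ x y, K x y ≤ C) (hh0 : ∀ x, 0 < h x)
    (hhB : ∀ x, h x ≤ B) (hwt0 : ∀ x, 0 < wt x) (hwi : Integrable wt ν) (hlam : 0 < lam)
    (heig : ∀ x, ∫ y, K x y * h y * wt y ∂ν = lam * h x)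
    (hnorm : ∫ y, h y ^ 2 * wt y ∂ν = 1) (hKs : ∀ x y, K x y = K y x)
    (hk : ∀ x y, k x y = ENNReal.ofReal (K x y)) (hφ : ∀ x, φ x = ENNReal.ofReal (h x))
    (hw : ∀ x, w x = ENNReal.ofReal (wt x)) (hL : L = ENNReal.ofReal lam)
    (hD : ∀ a n σ, D a n σ = φ (σ a) * φ (σ (a + n)) *
      (∏ j ∈ Finset.range n, k (σ (a + j)) (σ (a + j + 1)) * L⁻¹) *
      ∏ j ∈ Finset.range (n + 1), w (σ (a + j)))
    (hμ : ∀ (a : ℤ) (n : ℕ) (Φ : (ℤ → S) → ℝ≥0∞), Measurable Φ →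
      DependsOn Φ (↑(Finset.Icc a (a + n)) : Set ℤ) → ∀ η : ℤ → S,
        ∫⁻ σ, Φ σ ∂μ = (∫⋯∫⁻_Finset.Icc a (a + n), (fun σ => Φ σ * D a n σ) ∂fun _ : ℤ => ν) η)
    {g : (ℤ → S) → ℝ} (hgm : Measurable g) {b : ℤ} {m' : ℕ}
    (hgd : DependsOn g (↑(Finset.Icc b (b + m')) : Set ℤ)) {M : ℝ} (hg0 : ∀ σ, 0 ≤ g σ)
    (hgM : ∀ σ, g σ ≤ M) :
    ∃ G : S → ℝ, Measurable G ∧ (∀ y, 0 ≤ G y) ∧ (∀ y, G y ≤ M) ∧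
      ∀ (a : ℤ) (m : ℕ) (f : (ℤ → S) → ℝ), a + m = b → Measurable f → (∃ Mf, ∀ σ, |f σ| ≤ Mf) →
        DependsOn f (↑(Finset.Icc a (a + m)) : Set ℤ) →
          ∫ σ, f σ * g σ ∂μ = ∫ σ, f σ * G (σ b) ∂μ := by
  classical
  obtain ⟨hkm, hφm, hwm', hφ0, hφt, hw0', hwt', hL0, hLt, heig', -⟩ :=
    ennreal_transferData hKm hhm hwm hK0 hKC hh0 hhB hwt0 hwi hlam heig hnorm hk hφ hw hL
  have hsym : ∀ z y, k z y = k y z := fun z y => by rw [hk, hk, hKs]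
  have hM : 0 ≤ M := (hg0 (Classical.arbitrary _)).trans (hgM _)
  obtain ⟨Gt, hGtm, hGtM, hGt⟩ := exists_cond_of_le hkm hφm hwm' hL0 hLt heig' hsym hD hφ0 hφt
    hw0' hwt' hμ (Ψ := fun σ => ENNReal.ofReal (g σ)) (ENNReal.measurable_ofReal.comp hgm) (b := b)
    (m' := m') (fun x y hxy => by show ENNReal.ofReal (g x) = ENNReal.ofReal (g y); rw [hgd hxy])
    (M := ENNReal.ofReal M) (fun σ => ENNReal.ofReal_le_ofReal (hgM σ))
  have hGt_top : ∀ y, Gt y ≠ ∞ := fun y => ne_top_of_le_ne_top ENNReal.ofReal_ne_top (hGtM y)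
  refine ⟨fun y => (Gt y).toReal, ENNReal.measurable_toReal.comp hGtm, fun y => ENNReal.toReal_nonneg,
    fun y => ?_, fun a m f hab hfm ⟨Mf, hfM⟩ hfd => ?_⟩
  · have := ENNReal.toReal_mono ENNReal.ofReal_ne_top (hGtM y)
    rwa [ENNReal.toReal_ofReal hM] at this
  have hGm : Measurable fun σ : ℤ → S => (Gt (σ b)).toReal :=
    ENNReal.measurable_toReal.comp (hGtm.comp (measurable_pi_apply b))
  have hGb : ∀ σ : ℤ → S, |(Gt (σ b)).toReal| ≤ M := fun σ => by
    rw [abs_of_nonneg ENNReal.toReal_nonneg]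
    have := ENNReal.toReal_mono ENNReal.ofReal_ne_top (hGtM (σ b))
    rwa [ENNReal.toReal_ofReal hM] at this
  have hgb : ∀ σ, |g σ| ≤ M := fun σ => by rw [abs_of_nonneg (hg0 σ)]; exact hgM σ
  -- nonnegative `f` first
  have key : ∀ f' : (ℤ → S) → ℝ, Measurable f' → (∀ σ, 0 ≤ f' σ) →
      DependsOn f' (↑(Finset.Icc a (a + m)) : Set ℤ) →
      ∫ σ, f' σ * g σ ∂μ = ∫ σ, f' σ * (Gt (σ b)).toReal ∂μ := by
    intro f' hf'm hf'0 hf'd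
    refine integral_mul_eq_of_lintegral_ofReal_mul_eq hf'm hgm hGm hf'0 hg0
      (fun σ => ENNReal.toReal_nonneg) ?_
    rw [hGt a m (fun σ => ENNReal.ofReal (f' σ)) hab (ENNReal.measurable_ofReal.comp hf'm)
      (fun x y hxy => by show ENNReal.ofReal (f' x) = ENNReal.ofReal (f' y); rw [hf'd hxy])]
    refine lintegral_congr fun σ => ?_
    rw [ENNReal.ofReal_toReal (hGt_top _)]
  exact integral_mul_eq_of_posPart_negPart hfm hgm hGm hfM hgb hGb
    (key (fun σ => max (f σ) 0) (hfm.max measurable_const) (fun σ => le_max_right _ _)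
      fun x y hxy => by show max (f x) 0 = max (f y) 0; rw [hfd hxy])
    (key (fun σ => max (-f σ) 0) (hfm.neg.max measurable_const) (fun σ => le_max_right _ _)
      fun x y hxy => by show max (-f x) 0 = max (-f y) 0; rw [hfd hxy])

end RealForm

section Mixing

variable {k p : S → S → ℝ≥0∞} {φ w : S → ℝ≥0∞} {L : ℝ≥0∞} {K q : S → S → ℝ} {h wt : S → ℝ}
  {lam C B : ℝ} {D : ℤ → ℕ → (ℤ → S) → ℝ≥0∞} {μ : Measure (ℤ → S)}

/-! ### Two real-analysis helpers -/

/-- **Cauchy–Schwarz** for bounded measurable real functions on a finite measure space: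
`|∫ F V| ≤ (∫ F²)^{1/2} (∫ V²)^{1/2}`. [folklore] -/
theorem abs_integral_mul_le_rpow_half {Ω : Type*} [MeasurableSpace Ω] {μ' : Measure Ω}
    [IsFiniteMeasure μ'] {F V : Ω → ℝ} (hF : Measurable F) (hV : Measurable V) {MF MV : ℝ}
    (hFM : ∀ x, |F x| ≤ MF) (hVM : ∀ x, |V x| ≤ MV) :
    |∫ x, F x * V x ∂μ'| ≤ (∫ x, F x ^ 2 ∂μ') ^ (1 / 2 : ℝ) * (∫ x, V x ^ 2 ∂μ') ^ (1 / 2 : ℝ) := by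
  have hF2 : MemLp F (ENNReal.ofReal 2) μ' := MemLp.of_bound hF.aestronglyMeasurable MF
    (ae_of_all _ fun x => by rw [Real.norm_eq_abs]; exact hFM x)
  have hV2 : MemLp V (ENNReal.ofReal 2) μ' := MemLp.of_bound hV.aestronglyMeasurable MV
    (ae_of_all _ fun x => by rw [Real.norm_eq_abs]; exact hVM x)
  have h := integral_mul_norm_le_Lp_mul_Lq Real.HolderConjugate.two_two hF2 hV2
  simp only [Real.norm_eq_abs, Real.rpow_two, sq_abs] at h
  calc |∫ x, F x * V x ∂μ'| ≤ ∫ x, |F x * V x| ∂μ' := abs_integral_le_integral_abs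
    _ = ∫ x, |F x| * |V x| ∂μ' := by simp_rw [abs_mul]
    _ ≤ _ := h

/-- `((x ^ {1/2})² = x` for `x ≥ 0`. [folklore] -/
theorem rpow_half_sq {x : ℝ} (hx : 0 ≤ x) : (x ^ (1 / 2 : ℝ)) ^ 2 = x := by
  rw [← Real.rpow_natCast, ← Real.rpow_mul hx]
  norm_num

/-- `h² wt` is integrable, and so is `F h² wt` for a bounded measurable `F`. [folklore] -/
theorem integrable_mul_sq_mul_weight (hhm : Measurable h) (hwm : Measurable wt)
    (hh0 : ∀ x, 0 < h x) (hhB : ∀ x, h x ≤ B) (hwt0 : ∀ x, 0 < wt x) (hwi : Integrable wt ν)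
    {F : S → ℝ} (hFm : Measurable F) {MF : ℝ} (hFM : ∀ x, |F x| ≤ MF) :
    Integrable (fun y => F y * (h y ^ 2 * wt y)) ν := by
  have hr : Integrable (fun y => h y ^ 2 * wt y) ν := by
    refine (hwi.const_mul (B ^ 2)).mono' ((hhm.pow_const 2).mul hwm).aestronglyMeasurable
      (ae_of_all _ fun y => ?_)
    have h3 := hh0 y; have h4 := hhB y; have h5 := hwt0 y
    rw [Real.norm_eq_abs, abs_of_nonneg (by positivity)]
    have : h y ^ 2 ≤ B ^ 2 := pow_le_pow_left₀ h3.le h4 2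
    nlinarith
  exact hr.bdd_mul hFm.aestronglyMeasurable (ae_of_all _ fun y => by
    rw [Real.norm_eq_abs]; exact hFM y)

/-! ### The covariance bound for bounded window observables -/

/-- **Exponential decay of correlations of the transfer-operator Markov chain, bounded window
observables, nonnegative future observable.** With the `L²(h² wt dν)`-contraction hypothesis
`hgap` for the real one-step operator `P` on mean-zero bounded functions (rate `θ`), for bounded
measurable `f` of the window `{a, …, a+m}` and bounded measurable `g ≥ 0` of
`{a+m+n, …, a+m+n+m'}`:
`|∫ f g dμ - ∫ f dμ ∫ g dμ| ≤ θⁿ (∫ f² dμ)^{1/2} (∫ g² dμ)^{1/2}`. Proof: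
`Cov(f,g) = ∫ f(σ) (Pⁿ(G - c))(σ_{a+m}) dμ` with `G = E[g | σ_{a+m+n}]`, `c = ∫ g dμ` (conditioning
and the Markov property), Cauchy–Schwarz in `L²(μ)`, the one-site marginal, the gap, and Jensen
`∫ G² h² wt ≤ ∫ g² dμ`. [cite: Georgii2011, Thm 10.25 and §11.1] -/
theorem abs_integral_mul_sub_le_of_nonneg [Nonempty S] [SigmaFinite ν] [IsProbabilityMeasure μ]
    (hKm : Measurable (uncurry K)) (hhm : Measurable h)
    (hwm : Measurable wt) (hK0 : ∀ x y, 0 ≤ K x y) (hKC : ∀ x y, K x y ≤ C) (hh0 : ∀ x, 0 < h x)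
    (hhB : ∀ x, h x ≤ B) (hwt0 : ∀ x, 0 < wt x) (hwi : Integrable wt ν) (hlam : 0 < lam)
    (heig : ∀ x, ∫ y, K x y * h y * wt y ∂ν = lam * h x)
    (hnorm : ∫ y, h y ^ 2 * wt y ∂ν = 1) (hKs : ∀ x y, K x y = K y x)
    (hk : ∀ x y, k x y = ENNReal.ofReal (K x y)) (hφ : ∀ x, φ x = ENNReal.ofReal (h x))
    (hw : ∀ x, w x = ENNReal.ofReal (wt x)) (hL : L = ENNReal.ofReal lam)
    (hp : ∀ x y, p x y = (φ x)⁻¹ * L⁻¹ * k x y * φ y * w y)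
    (hq : ∀ x y, q x y = (lam * h x)⁻¹ * K x y * h y * wt y)
    (hD : ∀ a n σ, D a n σ = φ (σ a) * φ (σ (a + n)) *
      (∏ j ∈ Finset.range n, k (σ (a + j)) (σ (a + j + 1)) * L⁻¹) *
      ∏ j ∈ Finset.range (n + 1), w (σ (a + j)))
    (hμ : ∀ (a : ℤ) (n : ℕ) (Φ : (ℤ → S) → ℝ≥0∞), Measurable Φ →
      DependsOn Φ (↑(Finset.Icc a (a + n)) : Set ℤ) → ∀ η : ℤ → S,
        ∫⁻ σ, Φ σ ∂μ = (∫⋯∫⁻_Finset.Icc a (a + n), (fun σ => Φ σ * D a n σ) ∂fun _ : ℤ => ν) η)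
    {θ : ℝ} (hθ : 0 ≤ θ)
    (hgap : ∀ u : S → ℝ, Measurable u → (∃ M : ℝ, ∀ x, |u x| ≤ M) →
      ∫ x, u x * (h x ^ 2 * wt x) ∂ν = 0 → ∀ n : ℕ,
        ∫ x, ((fun (v : S → ℝ) (x : S) => ∫ y, q x y * v y ∂ν)^[n] u) x ^ 2 * (h x ^ 2 * wt x) ∂ν ≤
          θ ^ (2 * n) * ∫ x, u x ^ 2 * (h x ^ 2 * wt x) ∂ν)
    {f g : (ℤ → S) → ℝ} (hfm : Measurable f) {Mf : ℝ} (hfM : ∀ σ, |f σ| ≤ Mf) {a : ℤ} {m : ℕ}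
    (hfd : DependsOn f (↑(Finset.Icc a (a + m)) : Set ℤ)) (hgm : Measurable g) {Mg : ℝ}
    (hg0 : ∀ σ, 0 ≤ g σ) (hgM : ∀ σ, g σ ≤ Mg) {n m' : ℕ}
    (hgd : DependsOn g (↑(Finset.Icc (a + m + n) (a + m + n + m')) : Set ℤ)) :
    |∫ σ, f σ * g σ ∂μ - (∫ σ, f σ ∂μ) * (∫ σ, g σ ∂μ)| ≤
      θ ^ n * (∫ σ, f σ ^ 2 ∂μ) ^ (1 / 2 : ℝ) * (∫ σ, g σ ^ 2 ∂μ) ^ (1 / 2 : ℝ) := by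
  -- the conditional expectation `G = E[g | σ_b]`, `b = a + m + n`
  obtain ⟨G, hGm, hG0, hGM, hG⟩ := exists_realCond_of_le hKm hhm hwm hK0 hKC hh0 hhB hwt0 hwi hlam
    heig hnorm hKs hk hφ hw hL hD hμ hgm (b := a + m + n) (m' := m') hgd hg0 hgM
  have hGb : ∀ y, |G y| ≤ Mg := fun y => by rw [abs_of_nonneg (hG0 y)]; exact hGM y
  have hgb : ∀ σ, |g σ| ≤ Mg := fun σ => by rw [abs_of_nonneg (hg0 σ)]; exact hgM σ
  have hspec := fun {u : S → ℝ} (hum : Measurable u) {M : ℝ} (huM : ∀ x, |u x| ≤ M) =>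
    realMarkovOp_iterate_spec hKm hhm hwm hK0 hKC hh0 hhB hwt0 hwi hlam heig hq hum huM n
  have hmarg := fun {u : S → ℝ} (hum : Measurable u) (b : ℤ) =>
    integral_comp_eval_eq_real (k := k) (L := L) (μ := μ) hhm hwm hh0 hwt0 hφ hw hD hμ hum b
  have hintν := fun {F : S → ℝ} (hFm : Measurable F) {MF : ℝ} (hFM : ∀ x, |F x| ≤ MF) =>
    integrable_mul_sq_mul_weight hhm hwm hh0 hhB hwt0 hwi hFm hFM
  have hintμ : ∀ {F V : (ℤ → S) → ℝ}, Measurable F → Measurable V → ∀ {MF MV : ℝ},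
      (∀ σ, |F σ| ≤ MF) → (∀ σ, |V σ| ≤ MV) → Integrable (fun σ => F σ * V σ) μ := by
    intro F V hF hV MF MV hFM hVM
    refine integrable_of_bound_measurable (hF.mul hV) (M := MF * MV) fun σ => ?_
    rw [abs_mul]
    exact mul_le_mul (hFM σ) (hVM σ) (abs_nonneg _) ((abs_nonneg _).trans (hFM σ))
  -- (1) conditioning: `∫ f g = ∫ f G(σ_b)`
  have h1 : ∫ σ, f σ * g σ ∂μ = ∫ σ, f σ * G (σ (a + m + n)) ∂μ :=
    hG a (m + n) f (by push_cast; ring) hfm ⟨Mf, hfM⟩ (hfd.mono fun i hi => by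
      simp only [Finset.coe_Icc, Set.mem_Icc] at hi ⊢; push_cast; omega)
  -- (2) Markov property: `∫ f G(σ_b) = ∫ f (PⁿG)(σ_{a+m})`
  have h2 := integral_mul_comp_eval_add_real hKm hhm hwm hK0 hKC hh0 hhB hwt0 hwi hlam heig hnorm
    hk hφ hw hL hp hq hD hμ hfm hfM hfd hGm hGb hG0 n
  -- (3) `c = ∫ g dμ = ∫ G h² wt dν`
  set c : ℝ := ∫ σ, g σ ∂μ with hc
  have h3 : c = ∫ y, G y * (h y ^ 2 * wt y) ∂ν := by
    have h := hG (a + m + n) 0 (fun _ => (1 : ℝ)) (by simp) measurable_const ⟨1, fun _ => by simp⟩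
      (fun _ _ _ => rfl)
    simp only [one_mul] at h
    rw [hc, h, hmarg hGm]
  -- (4) `Cov(f, g) = ∫ f(σ) (Pⁿ(G - c))(σ_{a+m}) dμ`
  obtain ⟨hPm, hPM, -, hPc⟩ := hspec hGm hGb
  have hu₀m : Measurable fun y => G y - c := hGm.sub measurable_const
  have hu₀b : ∀ y, |G y - c| ≤ Mg + |c| := fun y =>
    (abs_sub _ _).trans (add_le_add (hGb y) le_rfl)
  obtain ⟨hUm, hUM, -, -⟩ := hspec hu₀m hu₀b
  set U : S → ℝ := (fun (v : S → ℝ) (x : S) => ∫ y, q x y * v y ∂ν)^[n] (fun y => G y - c) with hU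
  have h4 : ∫ σ, f σ * g σ ∂μ - (∫ σ, f σ ∂μ) * c = ∫ σ, f σ * U (σ (a + m)) ∂μ := by
    have hi1 : Integrable (fun σ => f σ *
        ((fun (v : S → ℝ) (x : S) => ∫ y, q x y * v y ∂ν)^[n] G) (σ (a + m))) μ :=
      hintμ hfm (hPm.comp (measurable_pi_apply _)) hfM fun σ => hPM _
    have hi2 : Integrable (fun σ => f σ * c) μ := (integrable_of_bound_measurable hfm hfM).mul_const c
    rw [hU, hPc c, h1, h2]
    simp_rw [mul_sub]
    rw [integral_sub hi1 hi2, integral_mul_const]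
  -- (5) the gap on the mean-zero function `G - c`
  have hmean : ∫ y, (G y - c) * (h y ^ 2 * wt y) ∂ν = 0 := by
    simp_rw [sub_mul]
    rw [integral_sub (hintν hGm hGb) ((hintν measurable_const (fun _ => le_rfl)).congr
      (ae_of_all _ fun y => rfl)), ← h3, integral_const_mul, hnorm, mul_one, sub_self]
  have h5 := hgap _ hu₀m ⟨_, hu₀b⟩ hmean n
  -- (6) Cauchy–Schwarz in `L²(μ)`
  have h6 : |∫ σ, f σ * U (σ (a + m)) ∂μ| ≤
      (∫ σ, f σ ^ 2 ∂μ) ^ (1 / 2 : ℝ) * (∫ σ, U (σ (a + m)) ^ 2 ∂μ) ^ (1 / 2 : ℝ) :=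
    abs_integral_mul_le_rpow_half (μ' := μ) (V := fun σ => U (σ (a + m))) hfm
      (hUm.comp (measurable_pi_apply (a + m))) hfM (fun σ => hUM _)
  -- (7) one-site marginal and the variance bound `∫ (G-c)² h² wt ≤ ∫ G² h² wt`
  have h7a : ∫ σ, U (σ (a + m)) ^ 2 ∂μ = ∫ y, U y ^ 2 * (h y ^ 2 * wt y) ∂ν :=
    hmarg (u := fun y => U y ^ 2) (hUm.pow_const 2) (a + m)
  have h7b : ∫ y, (G y - c) ^ 2 * (h y ^ 2 * wt y) ∂ν ≤ ∫ y, G y ^ 2 * (h y ^ 2 * wt y) ∂ν := by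
    have e : ∀ y, (G y - c) ^ 2 * (h y ^ 2 * wt y) =
        G y ^ 2 * (h y ^ 2 * wt y) - (2 * c) * (G y * (h y ^ 2 * wt y)) +
          c ^ 2 * ((fun _ => (1 : ℝ)) y * (h y ^ 2 * wt y)) := fun y => by ring
    have hG2b : ∀ y, |G y ^ 2| ≤ Mg ^ 2 := fun y => by
      rw [abs_pow]; exact pow_le_pow_left₀ (abs_nonneg _) (hGb y) 2
    have hiA : Integrable (fun y => G y ^ 2 * (h y ^ 2 * wt y)) ν := hintν (hGm.pow_const 2) hG2b
    have hiB : Integrable (fun y => (2 * c) * (G y * (h y ^ 2 * wt y))) ν :=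
      (hintν hGm hGb).const_mul _
    have hiC : Integrable (fun y => c ^ 2 * ((fun _ => (1 : ℝ)) y * (h y ^ 2 * wt y))) ν :=
      (hintν measurable_const (fun _ => le_rfl)).const_mul _
    have hiAB : Integrable (fun y => G y ^ 2 * (h y ^ 2 * wt y) - (2 * c) * (G y * (h y ^ 2 * wt y))) ν :=
      hiA.sub hiB
    simp_rw [e]
    rw [integral_add hiAB hiC, integral_sub hiA hiB, integral_const_mul, integral_const_mul, ← h3]
    simp only [one_mul]
    rw [hnorm]
    nlinarith [sq_nonneg c]
  -- (8) Jensen: `∫ G² h² wt dν = ∫ G(σ_b)² dμ ≤ ∫ g² dμ`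
  have h8 : ∫ y, G y ^ 2 * (h y ^ 2 * wt y) ∂ν ≤ ∫ σ, g σ ^ 2 ∂μ := by
    rw [← hmarg (hGm.pow_const 2) (a + m + n)]
    have e2 : ∫ σ, G (σ (a + m + n)) * g σ ∂μ = ∫ σ, G (σ (a + m + n)) * G (σ (a + m + n)) ∂μ :=
      hG (a + m + n) 0 (fun σ => G (σ (a + m + n))) (by simp) (hGm.comp (measurable_pi_apply _))
        ⟨Mg, fun σ => hGb _⟩ (fun x y hxy => by
          show G (x (a + m + n)) = G (y (a + m + n)); rw [hxy (a + m + n) (by simp)])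
    have cs : |∫ σ, G (σ (a + m + n)) * g σ ∂μ| ≤ (∫ σ, G (σ (a + m + n)) ^ 2 ∂μ) ^ (1 / 2 : ℝ) *
        (∫ σ, g σ ^ 2 ∂μ) ^ (1 / 2 : ℝ) :=
      abs_integral_mul_le_rpow_half (μ' := μ) (F := fun σ => G (σ (a + m + n)))
        (hGm.comp (measurable_pi_apply (a + m + n))) hgm (fun σ => hGb _) hgb
    set x := ∫ σ, G (σ (a + m + n)) ^ 2 ∂μ with hx
    set y := ∫ σ, g σ ^ 2 ∂μ with hy
    have hx0 : 0 ≤ x := integral_nonneg fun σ => sq_nonneg _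
    have hy0 : 0 ≤ y := integral_nonneg fun σ => sq_nonneg _
    have hxle : x ≤ x ^ (1 / 2 : ℝ) * y ^ (1 / 2 : ℝ) := by
      have hx' : x = ∫ σ, G (σ (a + m + n)) * g σ ∂μ := by
        rw [e2, hx]
        exact integral_congr_ae (ae_of_all _ fun σ => sq _)
      calc x = |∫ σ, G (σ (a + m + n)) * g σ ∂μ| := by
            rw [hx', abs_of_nonneg (integral_nonneg fun σ => mul_nonneg (hG0 _) (hg0 σ))]
        _ ≤ _ := cs
    nlinarith [Real.rpow_nonneg hx0 (1 / 2), Real.rpow_nonneg hy0 (1 / 2), rpow_half_sq hx0,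
      rpow_half_sq hy0, sq_nonneg (x ^ (1 / 2 : ℝ) - y ^ (1 / 2 : ℝ))]
  -- (9) assemble
  have hU0 : 0 ≤ ∫ σ, U (σ (a + m)) ^ 2 ∂μ := integral_nonneg fun σ => sq_nonneg _
  have hy0 : 0 ≤ ∫ σ, g σ ^ 2 ∂μ := integral_nonneg fun σ => sq_nonneg _
  have hθn : ((θ ^ n) ^ 2) ^ (1 / 2 : ℝ) = θ ^ n := by
    rw [← Real.rpow_natCast, ← Real.rpow_mul (pow_nonneg hθ n)]
    norm_num
  calc |∫ σ, f σ * g σ ∂μ - (∫ σ, f σ ∂μ) * c|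
      = |∫ σ, f σ * U (σ (a + m)) ∂μ| := by rw [h4]
    _ ≤ _ := h6
    _ ≤ (∫ σ, f σ ^ 2 ∂μ) ^ (1 / 2 : ℝ) * (θ ^ (2 * n) * ∫ σ, g σ ^ 2 ∂μ) ^ (1 / 2 : ℝ) := by
      gcongr
      rw [h7a]
      exact h5.trans (mul_le_mul_of_nonneg_left (h7b.trans h8) (pow_nonneg hθ _))
    _ = θ ^ n * (∫ σ, f σ ^ 2 ∂μ) ^ (1 / 2 : ℝ) * (∫ σ, g σ ^ 2 ∂μ) ^ (1 / 2 : ℝ) := by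
      rw [Real.mul_rpow (pow_nonneg hθ _) hy0, show θ ^ (2 * n) = (θ ^ n) ^ 2 by ring, hθn]
      ring

/-- `max(t, 0)² ≤ t²` and `max(-t, 0)² ≤ t²`. [folklore] -/
theorem max_zero_sq_le (t : ℝ) : max t 0 ^ 2 ≤ t ^ 2 ∧ max (-t) 0 ^ 2 ≤ t ^ 2 := by
  rcases le_or_gt 0 t with ht | ht
  · rw [max_eq_left ht, max_eq_right (neg_nonpos.2 ht)]
    exact ⟨le_rfl, by rw [zero_pow two_ne_zero]; positivity⟩
  · rw [max_eq_right ht.le, max_eq_left (neg_nonneg.2 ht.le), neg_sq]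
    exact ⟨by rw [zero_pow two_ne_zero]; positivity, le_rfl⟩

/-- **Exponential decay of correlations of the transfer-operator Markov chain, bounded window
observables.** As `abs_integral_mul_sub_le_of_nonneg`, for a bounded measurable `g` of either
sign (split `g = g⁺ - g⁻`; the constant becomes `2`):
`|∫ f g dμ - ∫ f dμ ∫ g dμ| ≤ 2 θⁿ (∫ f² dμ)^{1/2} (∫ g² dμ)^{1/2}`.
[cite: Georgii2011, Thm 10.25 and §11.1] -/
theorem abs_integral_mul_sub_le_of_window [Nonempty S] [SigmaFinite ν] [IsProbabilityMeasure μ]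
    (hKm : Measurable (uncurry K)) (hhm : Measurable h)
    (hwm : Measurable wt) (hK0 : ∀ x y, 0 ≤ K x y) (hKC : ∀ x y, K x y ≤ C) (hh0 : ∀ x, 0 < h x)
    (hhB : ∀ x, h x ≤ B) (hwt0 : ∀ x, 0 < wt x) (hwi : Integrable wt ν) (hlam : 0 < lam)
    (heig : ∀ x, ∫ y, K x y * h y * wt y ∂ν = lam * h x)
    (hnorm : ∫ y, h y ^ 2 * wt y ∂ν = 1) (hKs : ∀ x y, K x y = K y x)
    (hk : ∀ x y, k x y = ENNReal.ofReal (K x y)) (hφ : ∀ x, φ x = ENNReal.ofReal (h x))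
    (hw : ∀ x, w x = ENNReal.ofReal (wt x)) (hL : L = ENNReal.ofReal lam)
    (hp : ∀ x y, p x y = (φ x)⁻¹ * L⁻¹ * k x y * φ y * w y)
    (hq : ∀ x y, q x y = (lam * h x)⁻¹ * K x y * h y * wt y)
    (hD : ∀ a n σ, D a n σ = φ (σ a) * φ (σ (a + n)) *
      (∏ j ∈ Finset.range n, k (σ (a + j)) (σ (a + j + 1)) * L⁻¹) *
      ∏ j ∈ Finset.range (n + 1), w (σ (a + j)))
    (hμ : ∀ (a : ℤ) (n : ℕ) (Φ : (ℤ → S) → ℝ≥0∞), Measurable Φ →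
      DependsOn Φ (↑(Finset.Icc a (a + n)) : Set ℤ) → ∀ η : ℤ → S,
        ∫⁻ σ, Φ σ ∂μ = (∫⋯∫⁻_Finset.Icc a (a + n), (fun σ => Φ σ * D a n σ) ∂fun _ : ℤ => ν) η)
    {θ : ℝ} (hθ : 0 ≤ θ)
    (hgap : ∀ u : S → ℝ, Measurable u → (∃ M : ℝ, ∀ x, |u x| ≤ M) →
      ∫ x, u x * (h x ^ 2 * wt x) ∂ν = 0 → ∀ n : ℕ,
        ∫ x, ((fun (v : S → ℝ) (x : S) => ∫ y, q x y * v y ∂ν)^[n] u) x ^ 2 * (h x ^ 2 * wt x) ∂ν ≤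
          θ ^ (2 * n) * ∫ x, u x ^ 2 * (h x ^ 2 * wt x) ∂ν)
    {f g : (ℤ → S) → ℝ} (hfm : Measurable f) {Mf : ℝ} (hfM : ∀ σ, |f σ| ≤ Mf) {a : ℤ} {m : ℕ}
    (hfd : DependsOn f (↑(Finset.Icc a (a + m)) : Set ℤ)) (hgm : Measurable g) {Mg : ℝ}
    (hgM : ∀ σ, |g σ| ≤ Mg) {n m' : ℕ}
    (hgd : DependsOn g (↑(Finset.Icc (a + m + n) (a + m + n + m')) : Set ℤ)) :
    |∫ σ, f σ * g σ ∂μ - (∫ σ, f σ ∂μ) * (∫ σ, g σ ∂μ)| ≤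
      2 * θ ^ n * (∫ σ, f σ ^ 2 ∂μ) ^ (1 / 2 : ℝ) * (∫ σ, g σ ^ 2 ∂μ) ^ (1 / 2 : ℝ) := by
  have hcore := fun {g' : (ℤ → S) → ℝ} (hg'm : Measurable g') (hg'0 : ∀ σ, 0 ≤ g' σ)
      (hg'M : ∀ σ, g' σ ≤ Mg) (hg'd : DependsOn g' (↑(Finset.Icc (a + m + n) (a + m + n + m')) : Set ℤ)) =>
    abs_integral_mul_sub_le_of_nonneg hKm hhm hwm hK0 hKC hh0 hhB hwt0 hwi hlam heig hnorm hKs hk hφ hw hL hp hq hD hμ hθ hgap hfm hfM hfd hg'm hg'0 hg'M hg'd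
  have hMg : ∀ σ, |g σ| ≤ Mg := hgM
  have hpM : ∀ σ, max (g σ) 0 ≤ Mg := fun σ => max_le ((le_abs_self _).trans (hgM σ)) ((abs_nonneg _).trans (hgM σ))
  have hnM : ∀ σ, max (-g σ) 0 ≤ Mg := fun σ => max_le ((neg_le_abs _).trans (hgM σ)) ((abs_nonneg _).trans (hgM σ))
  have Hp := hcore (hgm.max measurable_const) (fun σ => le_max_right _ _) hpM
    (fun x y hxy => by show max (g x) 0 = max (g y) 0; rw [hgd hxy])
  have Hn := hcore (hgm.neg.max measurable_const) (fun σ => le_max_right _ _) hnM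
    (fun x y hxy => by show max (-g x) 0 = max (-g y) 0; rw [hgd hxy])
  -- integrability of the bounded pieces
  have hint : ∀ {F : (ℤ → S) → ℝ}, Measurable F → ∀ {MF : ℝ}, (∀ σ, |F σ| ≤ MF) → Integrable F μ :=
    fun hF _ hFM => integrable_of_bound_measurable hF hFM
  have hpb : ∀ σ, |max (g σ) 0| ≤ Mg := fun σ => by rw [abs_of_nonneg (le_max_right _ _)]; exact hpM σ
  have hnb : ∀ σ, |max (-g σ) 0| ≤ Mg := fun σ => by rw [abs_of_nonneg (le_max_right _ _)]; exact hnM σ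
  have hfpb : ∀ σ, |f σ * max (g σ) 0| ≤ Mf * Mg := fun σ => by
    rw [abs_mul]; exact mul_le_mul (hfM σ) (hpb σ) (abs_nonneg _) ((abs_nonneg _).trans (hfM σ))
  have hfnb : ∀ σ, |f σ * max (-g σ) 0| ≤ Mf * Mg := fun σ => by
    rw [abs_mul]; exact mul_le_mul (hfM σ) (hnb σ) (abs_nonneg _) ((abs_nonneg _).trans (hfM σ))
  have i1 : Integrable (fun σ => f σ * max (g σ) 0) μ :=
    hint (hfm.mul (hgm.max measurable_const)) hfpb
  have i2 : Integrable (fun σ => f σ * max (-g σ) 0) μ :=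
    hint (hfm.mul (hgm.neg.max measurable_const)) hfnb
  have i3 : Integrable (fun σ => max (g σ) 0) μ := hint (hgm.max measurable_const) hpb
  have i4 : Integrable (fun σ => max (-g σ) 0) μ := hint (hgm.neg.max measurable_const) hnb
  have e1 : ∫ σ, f σ * g σ ∂μ = ∫ σ, f σ * max (g σ) 0 ∂μ - ∫ σ, f σ * max (-g σ) 0 ∂μ := by
    rw [← integral_sub i1 i2]
    refine integral_congr_ae (ae_of_all _ fun σ => ?_)
    dsimp only
    rw [← mul_sub, max_zero_sub_max_neg_zero_eq_self]
  have e2 : ∫ σ, g σ ∂μ = ∫ σ, max (g σ) 0 ∂μ - ∫ σ, max (-g σ) 0 ∂μ := by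
    rw [← integral_sub i3 i4]
    refine integral_congr_ae (ae_of_all _ fun σ => ?_)
    dsimp only
    rw [max_zero_sub_max_neg_zero_eq_self]
  -- `∫ (g^±)² ≤ ∫ g²`
  have hg2b : ∀ σ, |g σ ^ 2| ≤ Mg ^ 2 := fun σ => by
    rw [abs_pow]; exact pow_le_pow_left₀ (abs_nonneg _) (hgM σ) 2
  have hp2b : ∀ σ, |max (g σ) 0 ^ 2| ≤ Mg ^ 2 := fun σ => by
    rw [abs_pow]; exact pow_le_pow_left₀ (abs_nonneg _) (hpb σ) 2
  have hn2b : ∀ σ, |max (-g σ) 0 ^ 2| ≤ Mg ^ 2 := fun σ => by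
    rw [abs_pow]; exact pow_le_pow_left₀ (abs_nonneg _) (hnb σ) 2
  have ip : (∫ σ, max (g σ) 0 ^ 2 ∂μ) ^ (1 / 2 : ℝ) ≤ (∫ σ, g σ ^ 2 ∂μ) ^ (1 / 2 : ℝ) :=
    Real.rpow_le_rpow (integral_nonneg fun σ => sq_nonneg _)
      (integral_mono (hint ((hgm.max measurable_const).pow_const 2) hp2b)
        (hint (hgm.pow_const 2) hg2b) fun σ => (max_zero_sq_le (g σ)).1) (by norm_num)
  have iN : (∫ σ, max (-g σ) 0 ^ 2 ∂μ) ^ (1 / 2 : ℝ) ≤ (∫ σ, g σ ^ 2 ∂μ) ^ (1 / 2 : ℝ) :=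
    Real.rpow_le_rpow (integral_nonneg fun σ => sq_nonneg _)
      (integral_mono (hint ((hgm.neg.max measurable_const).pow_const 2) hn2b)
        (hint (hgm.pow_const 2) hg2b) fun σ => (max_zero_sq_le (g σ)).2) (by norm_num)
  have h0 : 0 ≤ θ ^ n * (∫ σ, f σ ^ 2 ∂μ) ^ (1 / 2 : ℝ) :=
    mul_nonneg (pow_nonneg hθ _) (Real.rpow_nonneg (integral_nonneg fun σ => sq_nonneg _) _)
  calc |∫ σ, f σ * g σ ∂μ - (∫ σ, f σ ∂μ) * (∫ σ, g σ ∂μ)|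
      = |(∫ σ, f σ * max (g σ) 0 ∂μ - (∫ σ, f σ ∂μ) * ∫ σ, max (g σ) 0 ∂μ) -
          (∫ σ, f σ * max (-g σ) 0 ∂μ - (∫ σ, f σ ∂μ) * ∫ σ, max (-g σ) 0 ∂μ)| := by
        rw [e1, e2]; ring_nf
    _ ≤ |∫ σ, f σ * max (g σ) 0 ∂μ - (∫ σ, f σ ∂μ) * ∫ σ, max (g σ) 0 ∂μ| +
          |∫ σ, f σ * max (-g σ) 0 ∂μ - (∫ σ, f σ ∂μ) * ∫ σ, max (-g σ) 0 ∂μ| := abs_sub _ _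
    _ ≤ θ ^ n * (∫ σ, f σ ^ 2 ∂μ) ^ (1 / 2 : ℝ) * (∫ σ, max (g σ) 0 ^ 2 ∂μ) ^ (1 / 2 : ℝ) +
          θ ^ n * (∫ σ, f σ ^ 2 ∂μ) ^ (1 / 2 : ℝ) * (∫ σ, max (-g σ) 0 ^ 2 ∂μ) ^ (1 / 2 : ℝ) :=
        add_le_add Hp Hn
    _ ≤ θ ^ n * (∫ σ, f σ ^ 2 ∂μ) ^ (1 / 2 : ℝ) * (∫ σ, g σ ^ 2 ∂μ) ^ (1 / 2 : ℝ) +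
          θ ^ n * (∫ σ, f σ ^ 2 ∂μ) ^ (1 / 2 : ℝ) * (∫ σ, g σ ^ 2 ∂μ) ^ (1 / 2 : ℝ) :=
        add_le_add (mul_le_mul_of_nonneg_left ip h0) (mul_le_mul_of_nonneg_left iN h0)
    _ = 2 * θ ^ n * (∫ σ, f σ ^ 2 ∂μ) ^ (1 / 2 : ℝ) * (∫ σ, g σ ^ 2 ∂μ) ^ (1 / 2 : ℝ) := by ring

/-- **Exponential decay of correlations, observables of arbitrary finite windows** `{a', …, b}`
and `{b+n, …, b'}` at distance `n`:
`|∫ f g dμ - ∫ f dμ ∫ g dμ| ≤ 2 θⁿ (∫ f² dμ)^{1/2} (∫ g² dμ)^{1/2}`.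
[cite: Georgii2011, Thm 10.25 and §11.1] -/
theorem abs_integral_mul_sub_le_of_dependsOn_Icc [Nonempty S] [SigmaFinite ν]
    [IsProbabilityMeasure μ]
    (hKm : Measurable (uncurry K)) (hhm : Measurable h)
    (hwm : Measurable wt) (hK0 : ∀ x y, 0 ≤ K x y) (hKC : ∀ x y, K x y ≤ C) (hh0 : ∀ x, 0 < h x)
    (hhB : ∀ x, h x ≤ B) (hwt0 : ∀ x, 0 < wt x) (hwi : Integrable wt ν) (hlam : 0 < lam)
    (heig : ∀ x, ∫ y, K x y * h y * wt y ∂ν = lam * h x)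
    (hnorm : ∫ y, h y ^ 2 * wt y ∂ν = 1) (hKs : ∀ x y, K x y = K y x)
    (hk : ∀ x y, k x y = ENNReal.ofReal (K x y)) (hφ : ∀ x, φ x = ENNReal.ofReal (h x))
    (hw : ∀ x, w x = ENNReal.ofReal (wt x)) (hL : L = ENNReal.ofReal lam)
    (hp : ∀ x y, p x y = (φ x)⁻¹ * L⁻¹ * k x y * φ y * w y)
    (hq : ∀ x y, q x y = (lam * h x)⁻¹ * K x y * h y * wt y)
    (hD : ∀ a n σ, D a n σ = φ (σ a) * φ (σ (a + n)) *
      (∏ j ∈ Finset.range n, k (σ (a + j)) (σ (a + j + 1)) * L⁻¹) *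
      ∏ j ∈ Finset.range (n + 1), w (σ (a + j)))
    (hμ : ∀ (a : ℤ) (n : ℕ) (Φ : (ℤ → S) → ℝ≥0∞), Measurable Φ →
      DependsOn Φ (↑(Finset.Icc a (a + n)) : Set ℤ) → ∀ η : ℤ → S,
        ∫⁻ σ, Φ σ ∂μ = (∫⋯∫⁻_Finset.Icc a (a + n), (fun σ => Φ σ * D a n σ) ∂fun _ : ℤ => ν) η)
    {θ : ℝ} (hθ : 0 ≤ θ)
    (hgap : ∀ u : S → ℝ, Measurable u → (∃ M : ℝ, ∀ x, |u x| ≤ M) →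
      ∫ x, u x * (h x ^ 2 * wt x) ∂ν = 0 → ∀ n : ℕ,
        ∫ x, ((fun (v : S → ℝ) (x : S) => ∫ y, q x y * v y ∂ν)^[n] u) x ^ 2 * (h x ^ 2 * wt x) ∂ν ≤
          θ ^ (2 * n) * ∫ x, u x ^ 2 * (h x ^ 2 * wt x) ∂ν)
    {f g : (ℤ → S) → ℝ} (hfm : Measurable f) {Mf : ℝ} (hfM : ∀ σ, |f σ| ≤ Mf) {a' b : ℤ}
    (hfd : DependsOn f (↑(Finset.Icc a' b) : Set ℤ)) (hgm : Measurable g) {Mg : ℝ}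
    (hgM : ∀ σ, |g σ| ≤ Mg) {n : ℕ} {b' : ℤ}
    (hgd : DependsOn g (↑(Finset.Icc (b + n) b') : Set ℤ)) :
    |∫ σ, f σ * g σ ∂μ - (∫ σ, f σ ∂μ) * (∫ σ, g σ ∂μ)| ≤
      2 * θ ^ n * (∫ σ, f σ ^ 2 ∂μ) ^ (1 / 2 : ℝ) * (∫ σ, g σ ^ 2 ∂μ) ^ (1 / 2 : ℝ) := by
  obtain ⟨m, hm⟩ : ∃ m : ℕ, min a' b + m = b :=
    ⟨(b - min a' b).toNat, by rw [Int.toNat_of_nonneg (sub_nonneg.2 (min_le_right _ _))]; ring⟩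
  have hfd' : DependsOn f (↑(Finset.Icc (min a' b) (min a' b + m)) : Set ℤ) := hfd.mono (by
    rw [hm]
    intro i hi
    simp only [Finset.coe_Icc, Set.mem_Icc] at hi ⊢
    exact ⟨(min_le_left _ _).trans hi.1, hi.2⟩)
  have hgd' : DependsOn g
      (↑(Finset.Icc (min a' b + m + n) (min a' b + m + n + ↑((b' - (b + n)).toNat))) : Set ℤ) := by
    rw [hm]
    refine hgd.mono fun i hi => ?_
    simp only [Finset.coe_Icc, Set.mem_Icc] at hi ⊢
    omega
  exact abs_integral_mul_sub_le_of_window hKm hhm hwm hK0 hKC hh0 hhB hwt0 hwi hlam heig hnorm hKs hk hφ hw hL hp hq hD hμ hθ hgap hfm hfM hfd' hgm hgM hgd'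

/-! ### `L²` observables of the past and of the future -/

/-- `⟪[u], [v]⟫_{L²(μ)} = ∫ u v dμ` for `u, v ∈ L²`. [folklore] -/
theorem inner_toLp_eq_integral {Ω : Type*} [MeasurableSpace Ω] {μ' : Measure Ω} {u v : Ω → ℝ}
    (hu : MemLp u 2 μ') (hv : MemLp v 2 μ') :
    @inner ℝ _ _ (hu.toLp u) (hv.toLp v) = ∫ x, u x * v x ∂μ' := by
  rw [L2.inner_def]
  refine integral_congr_ae ?_
  filter_upwards [hu.coeFn_toLp, hv.coeFn_toLp] with x hx hy
  rw [hx, hy]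
  simp only [RCLike.inner_apply, conj_trivial]
  ring

/-- `‖[u]‖_{L²(μ)} = (∫ u² dμ)^{1/2}`. [folklore] -/
theorem norm_toLp_eq_rpow_half {Ω : Type*} [MeasurableSpace Ω] {μ' : Measure Ω} {u : Ω → ℝ}
    (hu : MemLp u 2 μ') : ‖hu.toLp u‖ = (∫ x, u x ^ 2 ∂μ') ^ (1 / 2 : ℝ) := by
  have h1 : ∫ x, u x ^ 2 ∂μ' = ‖hu.toLp u‖ ^ 2 := by
    rw [← real_inner_self_eq_norm_sq, inner_toLp_eq_integral hu hu]
    exact integral_congr_ae (ae_of_all _ fun x => sq _)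
  rw [h1, ← Real.sqrt_eq_rpow, Real.sqrt_sq (norm_nonneg _)]

/-- Approximation in `eLpNorm` at rate `1/(j+1)` gives convergence of the `L²` classes. [folklore] -/
theorem tendsto_toLp_of_eLpNorm_sub_le {Ω : Type*} [MeasurableSpace Ω] {μ' : Measure Ω}
    {u : Ω → ℝ} {U : ℕ → Ω → ℝ} (hu : MemLp u 2 μ') (hU : ∀ j, MemLp (U j) 2 μ')
    (hε : ∀ j : ℕ, eLpNorm (u - U j) 2 μ' ≤ ENNReal.ofReal (1 / ((j : ℝ) + 1))) :
    Tendsto (fun j => (hU j).toLp (U j)) atTop (nhds (hu.toLp u)) := by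
  rw [tendsto_iff_norm_sub_tendsto_zero]
  refine squeeze_zero (fun j => norm_nonneg _) (fun j => ?_) tendsto_one_div_add_atTop_nhds_zero_nat
  rw [← MemLp.toLp_sub, Lp.norm_toLp, eLpNorm_sub_comm, ← ENNReal.toReal_ofReal (by positivity :
    (0 : ℝ) ≤ 1 / ((j : ℝ) + 1))]
  exact ENNReal.toReal_mono ENNReal.ofReal_ne_top (hε j)

/-- A finite set of integers `≤ a` lies in a window `{a - N, …, a}`; one `≥ a` in `{a, …, a + N}`.
[folklore] -/
theorem finset_subset_Icc_of_le (I : Finset ℤ) (a : ℤ) :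
    ((∀ i ∈ I, i ≤ a) → ↑I ⊆ (↑(Finset.Icc (a - ↑(I.sup fun i => (a - i).toNat)) a) : Set ℤ)) ∧
    ((∀ i ∈ I, a ≤ i) → ↑I ⊆ (↑(Finset.Icc a (a + ↑(I.sup fun i => (i - a).toNat))) : Set ℤ)) := by
  constructor
  · intro hI i hi
    have hia : i ≤ a := hI i (Finset.mem_coe.1 hi)
    have hle : (a - i).toNat ≤ I.sup fun i => (a - i).toNat :=
      Finset.le_sup (f := fun i => (a - i).toNat) (Finset.mem_coe.1 hi)
    simp only [Finset.coe_Icc, Set.mem_Icc]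
    omega
  · intro hI i hi
    have hia : a ≤ i := hI i (Finset.mem_coe.1 hi)
    have hle : (i - a).toNat ≤ I.sup fun i => (i - a).toNat :=
      Finset.le_sup (f := fun i => (i - a).toNat) (Finset.mem_coe.1 hi)
    simp only [Finset.coe_Icc, Set.mem_Icc]
    omega

/-- **Exponential decay of correlations of the transfer-operator Markov chain: `L²` observables
of the past and of the future (exponential `ρ`-mixing).** Under the hypotheses of
`abs_integral_mul_sub_le_of_window`, for `f, g ∈ L²(μ)` measurable with `f` depending only on
the coordinates `≤ a` and `g` only on the coordinates `≥ a + n`,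
`|∫ f g dμ - ∫ f dμ ∫ g dμ| ≤ 2 θⁿ (∫ f² dμ)^{1/2} (∫ g² dμ)^{1/2}` (bounded cylinder functions
are dense in both `L²` spaces, `exists_bounded_cylinder_eLpNorm_sub_le_of_dependsOn`, and both
sides are continuous in `L²`). [cite: Georgii2011, Thm 10.25 and §11.1] -/
theorem abs_integral_mul_sub_le_of_dependsOn_halfLine [Nonempty S] [SigmaFinite ν]
    [IsProbabilityMeasure μ]
    (hKm : Measurable (uncurry K)) (hhm : Measurable h)
    (hwm : Measurable wt) (hK0 : ∀ x y, 0 ≤ K x y) (hKC : ∀ x y, K x y ≤ C) (hh0 : ∀ x, 0 < h x)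
    (hhB : ∀ x, h x ≤ B) (hwt0 : ∀ x, 0 < wt x) (hwi : Integrable wt ν) (hlam : 0 < lam)
    (heig : ∀ x, ∫ y, K x y * h y * wt y ∂ν = lam * h x)
    (hnorm : ∫ y, h y ^ 2 * wt y ∂ν = 1) (hKs : ∀ x y, K x y = K y x)
    (hk : ∀ x y, k x y = ENNReal.ofReal (K x y)) (hφ : ∀ x, φ x = ENNReal.ofReal (h x))
    (hw : ∀ x, w x = ENNReal.ofReal (wt x)) (hL : L = ENNReal.ofReal lam)
    (hp : ∀ x y, p x y = (φ x)⁻¹ * L⁻¹ * k x y * φ y * w y)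
    (hq : ∀ x y, q x y = (lam * h x)⁻¹ * K x y * h y * wt y)
    (hD : ∀ a n σ, D a n σ = φ (σ a) * φ (σ (a + n)) *
      (∏ j ∈ Finset.range n, k (σ (a + j)) (σ (a + j + 1)) * L⁻¹) *
      ∏ j ∈ Finset.range (n + 1), w (σ (a + j)))
    (hμ : ∀ (a : ℤ) (n : ℕ) (Φ : (ℤ → S) → ℝ≥0∞), Measurable Φ →
      DependsOn Φ (↑(Finset.Icc a (a + n)) : Set ℤ) → ∀ η : ℤ → S,
        ∫⁻ σ, Φ σ ∂μ = (∫⋯∫⁻_Finset.Icc a (a + n), (fun σ => Φ σ * D a n σ) ∂fun _ : ℤ => ν) η)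
    {θ : ℝ} (hθ : 0 ≤ θ)
    (hgap : ∀ u : S → ℝ, Measurable u → (∃ M : ℝ, ∀ x, |u x| ≤ M) →
      ∫ x, u x * (h x ^ 2 * wt x) ∂ν = 0 → ∀ n : ℕ,
        ∫ x, ((fun (v : S → ℝ) (x : S) => ∫ y, q x y * v y ∂ν)^[n] u) x ^ 2 * (h x ^ 2 * wt x) ∂ν ≤
          θ ^ (2 * n) * ∫ x, u x ^ 2 * (h x ^ 2 * wt x) ∂ν)
    {f g : (ℤ → S) → ℝ} (hfm : Measurable f) {a : ℤ} (hfd : DependsOn f {i : ℤ | i ≤ a})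
    (hgm : Measurable g) {n : ℕ} (hgd : DependsOn g {i : ℤ | a + n ≤ i})
    (hf2 : MemLp f 2 μ) (hg2 : MemLp g 2 μ) :
    |∫ σ, f σ * g σ ∂μ - (∫ σ, f σ ∂μ) * (∫ σ, g σ ∂μ)| ≤
      2 * θ ^ n * (∫ σ, f σ ^ 2 ∂μ) ^ (1 / 2 : ℝ) * (∫ σ, g σ ^ 2 ∂μ) ^ (1 / 2 : ℝ) := by
  -- approximating bounded cylinder functions
  have hε : ∀ j : ℕ, ENNReal.ofReal (1 / ((j : ℝ) + 1)) ≠ 0 := fun j =>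
    (ENNReal.ofReal_pos.2 (by positivity)).ne'
  have hF := fun j : ℕ => exists_bounded_cylinder_eLpNorm_sub_le_of_dependsOn (p := 2)
    ENNReal.ofNat_ne_top (μ := μ) hfm hfd hf2 (hε j)
  have hG' := fun j : ℕ => exists_bounded_cylinder_eLpNorm_sub_le_of_dependsOn (p := 2)
    ENNReal.ofNat_ne_top (μ := μ) hgm hgd hg2 (hε j)
  choose I F hI hFm hFd hFb hFε using hF
  choose J G hJ hGm hGd hGb hGε using hG'
  have hF2 : ∀ j, MemLp (F j) 2 μ := fun j => by
    obtain ⟨Bf, hBf⟩ := hFb j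
    exact MemLp.of_bound (hFm j).aestronglyMeasurable Bf (ae_of_all _ hBf)
  have hG2 : ∀ j, MemLp (G j) 2 μ := fun j => by
    obtain ⟨Bg, hBg⟩ := hGb j
    exact MemLp.of_bound (hGm j).aestronglyMeasurable Bg (ae_of_all _ hBg)
  -- the bound for the approximants
  have hbound : ∀ j, |∫ σ, F j σ * G j σ ∂μ - (∫ σ, F j σ ∂μ) * (∫ σ, G j σ ∂μ)| ≤
      2 * θ ^ n * (∫ σ, F j σ ^ 2 ∂μ) ^ (1 / 2 : ℝ) * (∫ σ, G j σ ^ 2 ∂μ) ^ (1 / 2 : ℝ) := by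
    intro j
    obtain ⟨Bf, hBf⟩ := hFb j
    obtain ⟨Bg, hBg⟩ := hGb j
    have hFd' := (hFd j).mono ((finset_subset_Icc_of_le (I j) a).1 fun i hi =>
      hI j (Finset.mem_coe.2 hi))
    have hGd' := (hGd j).mono ((finset_subset_Icc_of_le (J j) (a + n)).2 fun i hi =>
      hJ j (Finset.mem_coe.2 hi))
    exact abs_integral_mul_sub_le_of_dependsOn_Icc hKm hhm hwm hK0 hKC hh0 hhB hwt0 hwi hlam heig hnorm hKs hk hφ hw hL hp hq hD hμ hθ hgap (hFm j) (Mf := Bf)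
      (fun σ => by rw [← Real.norm_eq_abs]; exact hBf σ) hFd' (hGm j) (Mg := Bg)
      (fun σ => by rw [← Real.norm_eq_abs]; exact hBg σ) hGd'
  -- pass to the limit in `L²(μ)`
  have h1 : MemLp (fun _ : ℤ → S => (1 : ℝ)) 2 μ := memLp_const 1
  have hFt := tendsto_toLp_of_eLpNorm_sub_le hf2 hF2 hFε
  have hGt := tendsto_toLp_of_eLpNorm_sub_le hg2 hG2 hGε
  have hint1 : ∀ {u : (ℤ → S) → ℝ} (hu : MemLp u 2 μ),
      ∫ σ, u σ ∂μ = @inner ℝ _ _ (hu.toLp u) (h1.toLp _) :=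
    fun hu => by rw [inner_toLp_eq_integral hu h1]; simp
  have hlhs : Tendsto (fun j => |∫ σ, F j σ * G j σ ∂μ - (∫ σ, F j σ ∂μ) * (∫ σ, G j σ ∂μ)|) atTop
      (nhds |∫ σ, f σ * g σ ∂μ - (∫ σ, f σ ∂μ) * (∫ σ, g σ ∂μ)|) := by
    have e : ∀ {u v : (ℤ → S) → ℝ} (hu : MemLp u 2 μ) (hv : MemLp v 2 μ),
        ∫ σ, u σ * v σ ∂μ - (∫ σ, u σ ∂μ) * (∫ σ, v σ ∂μ) =
          @inner ℝ _ _ (hu.toLp u) (hv.toLp v) -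
            @inner ℝ _ _ (hu.toLp u) (h1.toLp _) * @inner ℝ _ _ (hv.toLp v) (h1.toLp _) :=
      fun hu hv => by rw [inner_toLp_eq_integral hu hv, ← hint1 hu, ← hint1 hv]
    simp_rw [e (hF2 _) (hG2 _), e hf2 hg2]
    exact ((hFt.inner hGt).sub ((hFt.inner tendsto_const_nhds).mul
      (hGt.inner tendsto_const_nhds))).abs
  have hrhs : Tendsto (fun j => 2 * θ ^ n * (∫ σ, F j σ ^ 2 ∂μ) ^ (1 / 2 : ℝ) *
      (∫ σ, G j σ ^ 2 ∂μ) ^ (1 / 2 : ℝ)) atTop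
      (nhds (2 * θ ^ n * (∫ σ, f σ ^ 2 ∂μ) ^ (1 / 2 : ℝ) * (∫ σ, g σ ^ 2 ∂μ) ^ (1 / 2 : ℝ))) := by
    simp_rw [← norm_toLp_eq_rpow_half (hF2 _), ← norm_toLp_eq_rpow_half (hG2 _),
      ← norm_toLp_eq_rpow_half hf2, ← norm_toLp_eq_rpow_half hg2]
    exact (hFt.norm.const_mul _).mul hGt.norm
  exact le_of_tendsto_of_tendsto' hlhs hrhs hbound

end Mixing

end Literature.Probability.LatticeModels

end
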